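import Literature.Analysis.FluidPDE.AxisymmetricLiftR5
import Literature.Analysis.FluidPDE.AxisymNoSwirlScalarEq
import Literature.Analysis.FluidPDE.KNSSMaxPrincipleR5
import Literature.Analysis.FluidPDE.KNSSThm52End
import Literature.Analysis.FluidPDE.KNSSThm52GoodTimes
import Literature.Analysis.FluidPDE.KNSSRegularityGluing
import Mathlib.MeasureTheory.Integral.DominatedConvergence
import HarnessLib

/-!
# KNSS 2009, Theorem 5.2: the assembly (from §4 regularity and Lemma 2.1 to `u = (0, 0, b₃(t))`)

Analysis/FluidPDE proofs file (all results proved) on the decomposition path of the named fact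
`Literature.Analysis.FluidPDE.KNSS2009_liouville_axisymmetric_no_swirl` (Koch–Nadirashvili–
Seregin–Šverák, *Liouville theorems for the Navier–Stokes equations and applications*, Acta
Math. 203 (2009) = arXiv:0709.3599, **Theorem 5.2**). The printed proof (p. 10): "By the results
of Section 4 `|∇ᵏu| ≤ C_k`; `f = ω_θ / r` is bounded with its derivatives (Remark 5.1) and
satisfies (5.10), whose diffusion part is the 5-dimensional Laplacian on `SO(4)`-invariant
functions; applying Lemma 2.1 as in Theorem 5.1, `f ≤ 0` and `f ≥ 0`, so `ω_θ = 0`, hence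
`ω = 0`, and the Liouville theorem for `curl u = 0`, `div u = 0` finishes the proof."

This file assembles the pieces vendored/proved along that path:

* §4 regularity as the named fact `KNSS2009_regularity_boundedWeak_ancient` (`KNSSRegularity`):
  `u = U + b(t)` with smooth bounded `U(t, ·)`, derivatives Lipschitz in `t`, the integrated
  vorticity equation;
* Lemma 2.1 on `ℝ⁵` as the named fact `KNSS2009_lemma21_halfball` and its consequence
  `KNSS2009_lemma21_halfball.eq_zero_of_abs_mul_le` (`KNSSMaxPrincipleR5`);
* the structure `ω = f J` of the vorticity of an axisymmetric swirl-free field and the smoothness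
  of `f = ω_θ / r` (`AxisymNoSwirlVorticity`, `HadamardQuotient`), the scalar equation (5.10)
  (`AxisymNoSwirlScalarEq`), the `SO(4)`-invariant lift to `ℝ⁵` (`AxisymmetricLiftR5`);
* the end of the proof (`KNSSThm52End.KNSS2009_thm52_of_curl_eq_zero'`, with the Liouville
  theorem for `curl = 0`, `div = 0`, `CurlFreeLiouville`).

Main results: `curl_eq_zero_of_KNSS2009_facts` (the vorticity of the regular part vanishes) and
`KNSS2009_liouville_axisymmetric_no_swirl_of_facts :
  KNSS2009_regularity_boundedWeak_ancient → KNSS2009_lemma21_halfball (EuclideanSpace ℝ (Fin 5)) →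
  KNSS2009_liouville_axisymmetric_no_swirl`.

## References

* G. Koch, N. Nadirashvili, G. Seregin, V. Šverák, *Liouville theorems for the Navier–Stokes
  equations and applications*, Acta Math. 203 (2009) 83–105 = arXiv:0709.3599: Theorem 5.2 and
  its proof (pp. 9–10), Remark 5.1, (5.10)–(5.12), Lemma 2.1 (p. 5), §4 (p. 8).
  [KochNadirashviliSereginSverak2009]
-/

noncomputable section

open Set Function Filter MeasureTheory Topology InnerProductSpace WithLp
open scoped RealInnerProductSpace Laplacian ContDiff

namespace Literature.Analysis.FluidPDE

/-! ### Norm bookkeeping: fixed linear functions of derivatives -/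

section Toolkit

variable {E F G : Type*} [NormedAddCommGroup E] [NormedSpace ℝ E] [NormedAddCommGroup F]
  [NormedSpace ℝ F] [NormedAddCommGroup G] [NormedSpace ℝ G]

/-- `k ≤ ∞` for the smoothness exponents (cast bookkeeping). [folklore] -/
theorem natCast_le_contDiff_infty (k : ℕ) : (k : WithTop ℕ∞) ≤ ∞ := by
  exact_mod_cast le_top

/-- `‖Dⁿ(Λ ∘ Dφ)(x)‖ ≤ ‖Λ‖ ‖Dⁿ⁺¹φ(x)‖` for a fixed continuous linear `Λ` and smooth `φ`. [folklore] -/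
theorem norm_iteratedFDeriv_clm_apply_fderiv_le (Λ : (E →L[ℝ] F) →L[ℝ] G) {φ : E → F}
    (hφ : ContDiff ℝ ∞ φ) (n : ℕ) (x : E) :
    ‖iteratedFDeriv ℝ n (fun z => Λ (fderiv ℝ φ z)) x‖ ≤ ‖Λ‖ * ‖iteratedFDeriv ℝ (n + 1) φ x‖ := by
  have hφ' : ContDiff ℝ (n + 1 : ℕ) φ := contDiff_infty.1 hφ (n + 1)
  have hf : ContDiff ℝ n (fderiv ℝ φ) := hφ'.fderiv_right (m := n) (by norm_cast)
  have h := ContinuousLinearMap.iteratedFDeriv_comp_left Λ (hf.contDiffAt (x := x)) (i := n) le_rfl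
  rw [show (fun z => Λ (fderiv ℝ φ z)) = Λ ∘ fderiv ℝ φ from rfl, h, ← norm_iteratedFDeriv_fderiv]
  exact Λ.norm_compContinuousMultilinearMap_le _

/-- `‖Dφ(x)‖ = ‖D¹φ(x)‖`. [folklore] -/
theorem norm_fderiv_eq_norm_iteratedFDeriv_one (φ : E → F) (x : E) :
    ‖fderiv ℝ φ x‖ = ‖iteratedFDeriv ℝ 1 φ x‖ := by
  have h := norm_iteratedFDeriv_fderiv (𝕜 := ℝ) (n := 0) (f := φ) (x := x)
  rwa [norm_iteratedFDeriv_zero] at h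

/-- `‖D(Dφ)(x)‖ = ‖D²φ(x)‖`. [folklore] -/
theorem norm_fderiv_fderiv_eq_norm_iteratedFDeriv_two (φ : E → F) (x : E) :
    ‖fderiv ℝ (fderiv ℝ φ) x‖ = ‖iteratedFDeriv ℝ 2 φ x‖ := by
  rw [norm_fderiv_eq_norm_iteratedFDeriv_one]
  exact norm_iteratedFDeriv_fderiv (𝕜 := ℝ) (n := 1) (f := φ) (x := x)

/-- The evaluation `T ↦ T v` has operator norm `≤ ‖v‖`. [folklore] -/
theorem norm_apply_clm_le (v : E) : ‖(ContinuousLinearMap.apply ℝ F v : (E →L[ℝ] F) →L[ℝ] F)‖ ≤ ‖v‖ :=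
  ContinuousLinearMap.opNorm_le_bound _ (norm_nonneg v) fun T => by
    rw [ContinuousLinearMap.apply_apply, mul_comm]; exact T.le_opNorm v

/-- `‖D(∂ᵥφ)(x)‖ ≤ ‖v‖ ‖D²φ(x)‖` for smooth `φ`. [folklore] -/
theorem norm_fderiv_fderiv_apply_le_of_smooth {φ : E → F} (hφ : ContDiff ℝ ∞ φ) (x v : E) :
    ‖fderiv ℝ (fun z => fderiv ℝ φ z v) x‖ ≤ ‖v‖ * ‖iteratedFDeriv ℝ 2 φ x‖ := by
  have h := norm_iteratedFDeriv_clm_apply_fderiv_le (ContinuousLinearMap.apply ℝ F v) hφ 1 x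
  simp only [ContinuousLinearMap.apply_apply] at h
  rw [← norm_fderiv_eq_norm_iteratedFDeriv_one] at h
  exact h.trans (mul_le_mul_of_nonneg_right (norm_apply_clm_le v) (norm_nonneg _))

/-- `‖D²(∂ᵥφ)(x)‖ ≤ ‖v‖ ‖D³φ(x)‖` for smooth `φ` (as the operator norm of `D(D(∂ᵥφ))(x)`). [folklore] -/
theorem norm_fderiv_fderiv_fderiv_apply_le_of_smooth {φ : E → F} (hφ : ContDiff ℝ ∞ φ) (x v : E) :
    ‖fderiv ℝ (fderiv ℝ (fun z => fderiv ℝ φ z v)) x‖ ≤ ‖v‖ * ‖iteratedFDeriv ℝ 3 φ x‖ := by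
  have h := norm_iteratedFDeriv_clm_apply_fderiv_le (ContinuousLinearMap.apply ℝ F v) hφ 2 x
  simp only [ContinuousLinearMap.apply_apply] at h
  rw [← norm_fderiv_fderiv_eq_norm_iteratedFDeriv_two] at h
  exact h.trans (mul_le_mul_of_nonneg_right (norm_apply_clm_le v) (norm_nonneg _))

/-- A directional derivative of a smooth function is smooth. [folklore] -/
theorem contDiff_infty_fderiv_apply {φ : E → F} (hφ : ContDiff ℝ ∞ φ) (v : E) :
    ContDiff ℝ ∞ fun z => fderiv ℝ φ z v :=
  (hφ.fderiv_right (m := ∞) le_rfl).clm_apply contDiff_const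

/-- Linearity of the directional derivative in the function. [folklore] -/
theorem fderiv_apply_sub_of_smooth {φ ψ : E → F} (hφ : ContDiff ℝ ∞ φ) (hψ : ContDiff ℝ ∞ ψ) (v : E) :
    (fun z => fderiv ℝ (φ - ψ) z v) = (fun z => fderiv ℝ φ z v) - fun z => fderiv ℝ ψ z v := by
  funext z
  rw [Pi.sub_apply, fderiv_sub ((hφ.differentiable (by simp)) z) ((hψ.differentiable (by simp)) z),
    _root_.sub_apply]

end Toolkit

/-! ### Time-continuity helpers on `(−∞, 0)` -/

section TimeContinuity

variable {X F : Type*} [TopologicalSpace X] [NormedAddCommGroup F]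

/-- **Joint continuity from a uniform Lipschitz bound in time and continuity in space**: if
`‖ψ(t, x) − ψ(s, x)‖ ≤ L |t − s|` for `s, t ∈ S` uniformly in `x`, and each `ψ(t, ·)`, `t ∈ S`, is
continuous, then `ψ` is continuous on `S × X`. [folklore] -/
theorem continuousOn_prod_of_lipschitz_time {ψ : ℝ → X → F} {S : Set ℝ} {L : ℝ}
    (hL : ∀ s ∈ S, ∀ t ∈ S, ∀ x, ‖ψ t x - ψ s x‖ ≤ L * |t - s|) (hc : ∀ t ∈ S, Continuous (ψ t)) :
    ContinuousOn (fun p : ℝ × X => ψ p.1 p.2) (S ×ˢ univ) := by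
  intro p hp
  rw [ContinuousWithinAt, Metric.tendsto_nhds]
  intro ε hε
  set L' : ℝ := max L 1 with hL'_def
  have hL'pos : 0 < L' := lt_of_lt_of_le one_pos (le_max_right _ _)
  have h1 : ∀ᶠ x in 𝓝 p.2, dist (ψ p.1 x) (ψ p.1 p.2) < ε / 2 :=
    Metric.tendsto_nhds.1 ((hc p.1 hp.1).tendsto p.2) (ε / 2) (by positivity)
  have h2 : ∀ᶠ t in 𝓝[S] p.1, t ∈ S ∧ dist t p.1 < ε / (2 * L') := by
    refine (eventually_mem_nhdsWithin).and ?_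
    exact (Metric.tendsto_nhds.1 (tendsto_id.mono_left nhdsWithin_le_nhds)) _ (by positivity)
  rw [nhdsWithin_prod_eq, nhdsWithin_univ]
  filter_upwards [h2.prod_mk h1] with q hq
  obtain ⟨⟨hqS, hqt⟩, hqx⟩ := hq
  have hA : dist (ψ q.1 q.2) (ψ p.1 q.2) ≤ ε / 2 := by
    rw [dist_eq_norm]
    calc ‖ψ q.1 q.2 - ψ p.1 q.2‖ ≤ L * |q.1 - p.1| := hL p.1 hp.1 q.1 hqS q.2
      _ ≤ L' * |q.1 - p.1| := mul_le_mul_of_nonneg_right (le_max_left _ _) (abs_nonneg _)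
      _ ≤ L' * (ε / (2 * L')) := by
          refine mul_le_mul_of_nonneg_left ?_ hL'pos.le
          rw [← Real.dist_eq]; exact hqt.le
      _ = ε / 2 := by field_simp
  calc dist (ψ q.1 q.2) (ψ p.1 p.2)
      ≤ dist (ψ q.1 q.2) (ψ p.1 q.2) + dist (ψ p.1 q.2) (ψ p.1 p.2) := dist_triangle _ _ _
    _ < ε / 2 + ε / 2 := add_lt_add_of_le_of_lt hA hqx
    _ = ε := by ring

/-- **From a.e. `t < 0` to every `t < 0` for functions continuous on `(−∞, 0)`.** [folklore] -/
theorem eq_of_ae_restrict_Iio_of_continuousOn {Y : Type*} [TopologicalSpace Y] [T2Space Y]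
    {g : ℝ → Y} {c : Y} (hg : ContinuousOn g (Iio 0))
    (hae : ∀ᵐ s ∂((volume : Measure ℝ).restrict (Iio 0)), g s = c) {t : ℝ} (ht : t < 0) : g t = c :=
  Measure.eqOn_open_of_ae_eq (f := g) (g := fun _ => c) hae isOpen_Iio hg continuousOn_const ht

end TimeContinuity

/-! ### The structure of the vorticity at every time -/

section Structure

variable {U : ℝ → EuclideanSpace ℝ (Fin 3) → EuclideanSpace ℝ (Fin 3)} {b : ℝ → EuclideanSpace ℝ (Fin 3)}

/-- The vorticity of `U(t) + b(t)` is that of `U(t)`. [folklore] -/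
theorem curl_add_const_eq (V : EuclideanSpace ℝ (Fin 3) → EuclideanSpace ℝ (Fin 3)) (c x : EuclideanSpace ℝ (Fin 3)) :
    curl (fun y => V y + c) x = curl V x := by
  rw [curl_eq_curlCLM, curl_eq_curlCLM, fderiv_add_const]

/-- The Lipschitz-in-time clause of the §4 fact, transported to the family of gradients (all
orders, including `0`). [folklore] -/
theorem lipschitz_fderiv_family_of_succ {L : ℕ → ℝ}
    (hlip : ∀ k : ℕ, 1 ≤ k → ∀ s < 0, ∀ t < 0, ∀ x,
      ‖iteratedFDeriv ℝ k (U t) x - iteratedFDeriv ℝ k (U s) x‖ ≤ L k * |t - s|) :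
    ∀ k : ℕ, ∀ s ∈ Iio (0 : ℝ), ∀ t ∈ Iio (0 : ℝ), ∀ x,
      ‖iteratedFDeriv ℝ k (fderiv ℝ (U t)) x - iteratedFDeriv ℝ k (fderiv ℝ (U s)) x‖ ≤
        L (k + 1) * |t - s| := by
  intro k s hs t ht x
  rw [norm_iteratedFDeriv_fderiv_sub]
  exact hlip (k + 1) (by omega) s hs t ht x

/-- Continuity in time of the vorticity at a point, on `(−∞, 0)`. [folklore] -/
theorem continuousOn_curl_of_lipschitz_succ {L : ℕ → ℝ}
    (hlip : ∀ k : ℕ, 1 ≤ k → ∀ s < 0, ∀ t < 0, ∀ x,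
      ‖iteratedFDeriv ℝ k (U t) x - iteratedFDeriv ℝ k (U s) x‖ ≤ L k * |t - s|)
    (x : EuclideanSpace ℝ (Fin 3)) : ContinuousOn (fun t => curl (U t) x) (Iio 0) := by
  have h := continuousOn_apply_family (V := fun t => fderiv ℝ (U t)) (lipschitz_fderiv_family_of_succ hlip) x
  simp_rw [curl_eq_curlCLM]
  exact curlCLM.continuous.comp_continuousOn h

/-- **The structure of the vorticity at every `t < 0`.** If `U(t, ·)` is smooth with derivatives
Lipschitz in `t` on `(−∞, 0)` and `U(t) + b(t)` is axisymmetric and swirl free for a.e. `t < 0`,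
then for **every** `t < 0`: `(curl U(t))₂ = 0`, `x₀ (curl U(t))₀ + x₁ (curl U(t))₁ = 0`
(`AxisymNoSwirlVorticity`) and `curl U(t)` is axisymmetric — the three identities are closed
under the pointwise-in-`x` continuity of `t ↦ curl U(t)(x)`. [folklore] -/
theorem curl_structure_of_ae (hsmooth : ∀ t < 0, ContDiff ℝ ∞ (U t)) {L : ℕ → ℝ}
    (hlip : ∀ k : ℕ, 1 ≤ k → ∀ s < 0, ∀ t < 0, ∀ x,
      ‖iteratedFDeriv ℝ k (U t) x - iteratedFDeriv ℝ k (U s) x‖ ≤ L k * |t - s|)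
    (hgood : ∀ᵐ t ∂((volume : Measure ℝ).restrict (Iio 0)),
      IsAxisymmetric (fun x => U t x + b t) ∧ HasNoSwirl (fun x => U t x + b t)) :
    ∀ t < 0, (∀ x : EuclideanSpace ℝ (Fin 3), curl (U t) x 2 = 0) ∧
      (∀ x : EuclideanSpace ℝ (Fin 3), x 0 * curl (U t) x 0 + x 1 * curl (U t) x 1 = 0) ∧
      IsAxisymmetric (curl (U t)) := by
  -- the identities for a.e. `t`
  have hae : ∀ᵐ t ∂((volume : Measure ℝ).restrict (Iio 0)),
      (∀ x : EuclideanSpace ℝ (Fin 3), curl (U t) x 2 = 0) ∧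
      (∀ x : EuclideanSpace ℝ (Fin 3), x 0 * curl (U t) x 0 + x 1 * curl (U t) x 1 = 0) ∧
      ∀ θ x, curl (U t) (rotZ θ x) - rotZ θ (curl (U t) x) = 0 := by
    filter_upwards [hgood, ae_restrict_mem measurableSet_Iio] with t ht htneg
    have htneg : t < 0 := htneg
    obtain ⟨hax, hsw⟩ := ht
    have hv : ContDiff ℝ 1 fun x => U t x + b t := ((hsmooth t htneg).of_le (by simp)).add contDiff_const
    have hcurl : ∀ x, curl (fun y => U t y + b t) x = curl (U t) x := fun x => curl_add_const_eq _ _ _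
    refine ⟨fun x => ?_, fun x => ?_, fun θ x => ?_⟩
    · rw [← hcurl]; exact curl_apply_two_eq_zero hax hsw hv x
    · rw [← hcurl]; exact inner_curl_horizontal_eq_zero hax hsw ((hv.differentiable one_ne_zero) x)
    · have h := (hax.curl (hv.differentiable one_ne_zero)) θ x
      rw [hcurl, hcurl] at h
      rw [h, sub_self]
  intro t ht
  have hc : ∀ x, ContinuousOn (fun s => curl (U s) x) (Iio 0) := continuousOn_curl_of_lipschitz_succ hlip
  have hproj : ∀ i : Fin 3, Continuous fun v : EuclideanSpace ℝ (Fin 3) => v i := fun i =>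
    (EuclideanSpace.proj i).continuous
  refine ⟨fun x => ?_, fun x => ?_, fun θ x => ?_⟩
  · exact eq_of_ae_restrict_Iio_of_continuousOn ((hproj 2).comp_continuousOn (hc x))
      (hae.mono fun s hs => hs.1 x) ht
  · exact eq_of_ae_restrict_Iio_of_continuousOn
      ((continuousOn_const.mul ((hproj 0).comp_continuousOn (hc x))).add
        (continuousOn_const.mul ((hproj 1).comp_continuousOn (hc x))))
      (hae.mono fun s hs => hs.2.1 x) ht
  · have h := eq_of_ae_restrict_Iio_of_continuousOn
      ((hc (rotZ θ x)).sub ((rotZLIE θ).continuous.comp_continuousOn (hc x)))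
      (hae.mono fun s hs => hs.2.2 θ x) ht
    exact sub_eq_zero.1 h

/-- **`f = ω_θ / r` is an axisymmetric scalar** when the vorticity `ω` is an axisymmetric vector
field of the form `ω = f J` (`J x = (−x₁, x₀, 0)`): `f(Rx) J(Rx) = R(f(x) J x) = f(x) J(Rx)`, and
`J(Rx) ≠ 0` off the axis. [folklore] -/
theorem isAxisymmetricScalar_of_curl_structure {V : EuclideanSpace ℝ (Fin 3) → EuclideanSpace ℝ (Fin 3)}
    (hωax : IsAxisymmetric (curl V)) (hV : ContDiff ℝ 2 V)
    (h2 : ∀ x : EuclideanSpace ℝ (Fin 3), curl V x 2 = 0)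
    (hb : ∀ x : EuclideanSpace ℝ (Fin 3), x 0 * curl V x 0 + x 1 * curl V x 1 = 0) :
    IsAxisymmetricScalar (hadamardQuotFst fun y => curl V y 1) := by
  intro θ x
  set f := hadamardQuotFst (fun y => curl V y 1) with hf
  have hω : ContDiff ℝ 1 (curl V) := contDiff_curl (n := 1) (by exact_mod_cast hV)
  have h := hωax θ x
  rw [eq_hadamardQuotFst_smul_rotGen hω h2 hb (rotZ θ x), eq_hadamardQuotFst_smul_rotGen hω h2 hb x,
    rotGen_rotZ] at h
  have hlin : rotZ θ (f x • rotGen x) = f x • rotZ θ (rotGen x) := by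
    ext i; fin_cases i <;> simp <;> ring
  rw [hlin] at h
  have hsub : (f (rotZ θ x) - f x) • rotZ θ (rotGen x) = 0 := by rw [sub_smul, h, sub_self]
  by_cases hax' : x 0 = 0 ∧ x 1 = 0
  · rw [rotZ_eq_self_of_axis θ hax'.1 hax'.2]
  · have hne : rotZ θ (rotGen x) ≠ 0 := by
      intro hz
      have hn : ‖rotZ θ (rotGen x)‖ = 0 := by rw [hz, norm_zero]
      rw [norm_rotZ, norm_eq_zero] at hn
      have h0' := congrFun (congrArg (⇑) hn) 0
      have h1' := congrFun (congrArg (⇑) hn) 1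
      simp only [rotGen_apply_zero, rotGen_apply_one, PiLp.zero_apply, neg_eq_zero] at h0' h1'
      exact hax' ⟨h1', h0'⟩
    have := (smul_eq_zero.1 hsub).resolve_right hne
    linarith

end Structure

/-! ### The scalar `f = ω_θ / r` of the regular part: smoothness, bounds, Lipschitz in time -/

section Scalar

/-- Linearity of the Hadamard quotient (for `C¹` functions, whose integrands are continuous). [folklore] -/
theorem hadamardQuotFst_sub {w₁ w₂ : EuclideanSpace ℝ (Fin 3) → ℝ} (hw₁ : ContDiff ℝ 1 w₁)
    (hw₂ : ContDiff ℝ 1 w₂) : hadamardQuotFst (w₁ - w₂) = hadamardQuotFst w₁ - hadamardQuotFst w₂ := by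
  funext x
  have hcont : ∀ {w : EuclideanSpace ℝ (Fin 3) → ℝ}, ContDiff ℝ 1 w →
      Continuous fun s : ℝ => fderiv ℝ w (scaleFst s x) (EuclideanSpace.single 0 1) := fun hw =>
    ((hw.continuous_fderiv one_ne_zero).comp ((contDiff_scaleFst_uncurry (n := 0)).continuous.comp
      (continuous_const.prodMk continuous_id))).clm_apply continuous_const
  rw [Pi.sub_apply]
  unfold hadamardQuotFst
  rw [← intervalIntegral.integral_sub ((hcont hw₁).intervalIntegrable _ _)
    ((hcont hw₂).intervalIntegrable _ _)]
  refine intervalIntegral.integral_congr fun s _ => ?_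
  rw [fderiv_sub ((hw₁.differentiable one_ne_zero) _) ((hw₂.differentiable one_ne_zero) _),
    _root_.sub_apply]

/-- **Bounds for the lift data of `f = hadamardQuotFst w`** in terms of sup norms of `D²w`, `D³w`:
`‖Df‖ ≤ B₂`, `‖D(∂ᵢ f)‖ ≤ B₃`, `|hadamardQuotFst (∂₀ f)| ≤ B₃` (`HadamardQuotient` sup bounds). [folklore] -/
theorem hadamardQuotFst_liftData_bounds {w : EuclideanSpace ℝ (Fin 3) → ℝ} (hw : ContDiff ℝ ∞ w)
    {B₂ B₃ : ℝ} (h2 : ∀ y, ‖iteratedFDeriv ℝ 2 w y‖ ≤ B₂) (h3 : ∀ y, ‖iteratedFDeriv ℝ 3 w y‖ ≤ B₃)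
    (x : EuclideanSpace ℝ (Fin 3)) :
    ‖fderiv ℝ (hadamardQuotFst w) x‖ ≤ B₂ ∧
    (∀ i : Fin 3, ‖fderiv ℝ (fun z => fderiv ℝ (hadamardQuotFst w) z (EuclideanSpace.single i 1)) x‖ ≤ B₃) ∧
    |hadamardQuotFst (fun z => fderiv ℝ (hadamardQuotFst w) z (EuclideanSpace.single 0 1)) x| ≤ B₃ := by
  have hB2 : ∀ y, ‖fderiv ℝ (fun y => fderiv ℝ w y (EuclideanSpace.single 0 1)) y‖ ≤ B₂ := fun y => by
    have h := norm_fderiv_fderiv_apply_le_of_smooth hw y (EuclideanSpace.single 0 1)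
    rw [PiLp.norm_single, norm_one, one_mul] at h
    exact h.trans (h2 y)
  have hB3 : ∀ y, ‖fderiv ℝ (fderiv ℝ (fun y => fderiv ℝ w y (EuclideanSpace.single 0 1))) y‖ ≤ B₃ :=
    fun y => by
    have h := norm_fderiv_fderiv_fderiv_apply_le_of_smooth hw y (EuclideanSpace.single 0 1)
    rw [PiLp.norm_single, norm_one, one_mul] at h
    exact h.trans (h3 y)
  have hw2 : ContDiff ℝ 2 w := hw.of_le (by norm_cast)
  have hw3 : ContDiff ℝ 3 w := hw.of_le (by norm_cast)
  have hB30 : 0 ≤ B₃ :=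
    le_trans (norm_nonneg (fderiv ℝ (fderiv ℝ fun y => fderiv ℝ w y
      (EuclideanSpace.single 0 1)) 0)) (hB3 0)
  have hdir : ∀ (x : EuclideanSpace ℝ (Fin 3)) (i : Fin 3),
      ‖fderiv ℝ (fun z => fderiv ℝ (hadamardQuotFst w) z (EuclideanSpace.single i 1)) x‖ ≤ B₃ := by
    intro x i
    refine ContinuousLinearMap.opNorm_le_bound _ hB30 fun k => ?_
    have h := norm_fderiv_fderiv_hadamardQuotFst_apply_le hw3 hB3 x (EuclideanSpace.single i 1) k
    rwa [PiLp.norm_single, norm_one, mul_one] at h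
  refine ⟨norm_fderiv_hadamardQuotFst_le hw2 hB2 x, hdir x, ?_⟩
  have h := norm_hadamardQuotFst_le (w := fun z => fderiv ℝ (hadamardQuotFst w) z (EuclideanSpace.single 0 1))
    (fun y => hdir y 0) x
  rwa [Real.norm_eq_abs] at h

/-- **Lipschitz dependence of the lift data on `w`**: for smooth `w₁, w₂` with
`‖D²w₁ − D²w₂‖ ≤ D₂`, `‖D³w₁ − D³w₂‖ ≤ D₃`, the quantities `f`, `∂₂ f`, `∂₀∂₀ f`, `∂₂∂₂ f`,
`hadamardQuotFst (∂₀ f)` and `Df` of `f = hadamardQuotFst w` differ by at most `D₂`/`D₃`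
(everything is linear in `w`). [folklore] -/
theorem hadamardQuotFst_liftData_sub_bounds {w₁ w₂ : EuclideanSpace ℝ (Fin 3) → ℝ}
    (hw₁ : ContDiff ℝ ∞ w₁) (hw₂ : ContDiff ℝ ∞ w₂) {D₁ D₂ D₃ : ℝ}
    (h1 : ∀ y, ‖iteratedFDeriv ℝ 1 w₁ y - iteratedFDeriv ℝ 1 w₂ y‖ ≤ D₁)
    (h2 : ∀ y, ‖iteratedFDeriv ℝ 2 w₁ y - iteratedFDeriv ℝ 2 w₂ y‖ ≤ D₂)
    (h3 : ∀ y, ‖iteratedFDeriv ℝ 3 w₁ y - iteratedFDeriv ℝ 3 w₂ y‖ ≤ D₃)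
    (x : EuclideanSpace ℝ (Fin 3)) :
    |hadamardQuotFst w₁ x - hadamardQuotFst w₂ x| ≤ D₁ ∧
    ‖fderiv ℝ (hadamardQuotFst w₁) x - fderiv ℝ (hadamardQuotFst w₂) x‖ ≤ D₂ ∧
    (∀ i : Fin 3, |fderiv ℝ (fun z => fderiv ℝ (hadamardQuotFst w₁) z (EuclideanSpace.single i 1)) x
        (EuclideanSpace.single i 1) -
      fderiv ℝ (fun z => fderiv ℝ (hadamardQuotFst w₂) z (EuclideanSpace.single i 1)) x
        (EuclideanSpace.single i 1)| ≤ D₃) ∧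
    |hadamardQuotFst (fun z => fderiv ℝ (hadamardQuotFst w₁) z (EuclideanSpace.single 0 1)) x -
      hadamardQuotFst (fun z => fderiv ℝ (hadamardQuotFst w₂) z (EuclideanSpace.single 0 1)) x| ≤ D₃ := by
  set w : EuclideanSpace ℝ (Fin 3) → ℝ := w₁ - w₂ with hw_def
  have hw : ContDiff ℝ ∞ w := hw₁.sub hw₂
  have hf₁ : ContDiff ℝ ∞ (hadamardQuotFst w₁) := contDiff_hadamardQuotFst hw₁
  have hf₂ : ContDiff ℝ ∞ (hadamardQuotFst w₂) := contDiff_hadamardQuotFst hw₂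
  have hsub : hadamardQuotFst w = hadamardQuotFst w₁ - hadamardQuotFst w₂ :=
    hadamardQuotFst_sub (hw₁.of_le (by norm_cast)) (hw₂.of_le (by norm_cast))
  have hiter : ∀ (k : ℕ) (y : EuclideanSpace ℝ (Fin 3)),
      iteratedFDeriv ℝ k w y = iteratedFDeriv ℝ k w₁ y - iteratedFDeriv ℝ k w₂ y := fun k y =>
    iteratedFDeriv_sub_apply (hw₁.of_le (natCast_le_contDiff_infty k)).contDiffAt
      (hw₂.of_le (natCast_le_contDiff_infty k)).contDiffAt
  have h2' : ∀ y, ‖iteratedFDeriv ℝ 2 w y‖ ≤ D₂ := fun y => by rw [hiter]; exact h2 y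
  have h3' : ∀ y, ‖iteratedFDeriv ℝ 3 w y‖ ≤ D₃ := fun y => by rw [hiter]; exact h3 y
  obtain ⟨hD, hdir, hq⟩ := hadamardQuotFst_liftData_bounds hw h2' h3' x
  -- linearity of the directional derivatives
  have hdsub : ∀ v : EuclideanSpace ℝ (Fin 3), (fun z => fderiv ℝ (hadamardQuotFst w) z v) =
      (fun z => fderiv ℝ (hadamardQuotFst w₁) z v) - fun z => fderiv ℝ (hadamardQuotFst w₂) z v := by
    intro v; rw [hsub]; exact fderiv_apply_sub_of_smooth hf₁ hf₂ v
  have hddsub : ∀ v : EuclideanSpace ℝ (Fin 3), fderiv ℝ (fun z => fderiv ℝ (hadamardQuotFst w) z v) x v =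
      fderiv ℝ (fun z => fderiv ℝ (hadamardQuotFst w₁) z v) x v -
        fderiv ℝ (fun z => fderiv ℝ (hadamardQuotFst w₂) z v) x v := by
    intro v
    rw [hdsub v, fderiv_sub (((contDiff_infty_fderiv_apply hf₁ v).differentiable (by simp)) x)
      (((contDiff_infty_fderiv_apply hf₂ v).differentiable (by simp)) x), _root_.sub_apply]
  refine ⟨?_, ?_, fun i => ?_, ?_⟩
  · -- values: `|hQ w x| ≤ sup ‖Dw‖ ≤ D₁`
    have hB1 : ∀ y, ‖fderiv ℝ w y‖ ≤ D₁ := fun y => by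
      rw [norm_fderiv_eq_norm_iteratedFDeriv_one, hiter]; exact h1 y
    have h := norm_hadamardQuotFst_le hB1 x
    rwa [hsub, Pi.sub_apply, Real.norm_eq_abs] at h
  · have h := hD
    rwa [hsub, fderiv_sub ((hf₁.differentiable (by simp)) x) ((hf₂.differentiable (by simp)) x)] at h
  · rw [← hddsub]
    exact (abs_fderiv_apply_single_le _ _).trans (hdir i)
  · have hqsub : hadamardQuotFst (fun z => fderiv ℝ (hadamardQuotFst w) z (EuclideanSpace.single 0 1)) =
        hadamardQuotFst (fun z => fderiv ℝ (hadamardQuotFst w₁) z (EuclideanSpace.single 0 1)) -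
          hadamardQuotFst (fun z => fderiv ℝ (hadamardQuotFst w₂) z (EuclideanSpace.single 0 1)) := by
      rw [hdsub]
      exact hadamardQuotFst_sub ((contDiff_infty_fderiv_apply hf₁ _).of_le (by norm_cast))
        ((contDiff_infty_fderiv_apply hf₂ _).of_le (by norm_cast))
    have h := hq
    rwa [hqsub, Pi.sub_apply] at h

variable {U : ℝ → EuclideanSpace ℝ (Fin 3) → EuclideanSpace ℝ (Fin 3)}

/-- The linear function `θ`-coordinate-of-`curl`: `ω₁ = Λ₁ ∘ DU`. [folklore] -/
theorem curl_apply_one_eq_clm (V : EuclideanSpace ℝ (Fin 3) → EuclideanSpace ℝ (Fin 3)) :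
    (fun y => curl V y 1) = fun y =>
      ((EuclideanSpace.proj (1 : Fin 3) : EuclideanSpace ℝ (Fin 3) →L[ℝ] ℝ).comp curlCLM) (fderiv ℝ V y) := by
  funext y
  rw [ContinuousLinearMap.comp_apply, ← curl_eq_curlCLM]
  rfl

/-- **`ω₁(t) = (curl U(t))₁` is smooth, with all derivatives bounded and Lipschitz in `t`**, for
a family as furnished by `KNSS2009_regularity_boundedWeak_ancient`. [folklore] -/
theorem curl_apply_one_family (hsmooth : ∀ t < 0, ContDiff ℝ ∞ (U t)) {C : ℕ → ℝ}
    (hC : ∀ k : ℕ, ∀ t < 0, ∀ x, ‖iteratedFDeriv ℝ k (U t) x‖ ≤ C k) {L : ℕ → ℝ}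
    (hL : ∀ k : ℕ, 1 ≤ k → ∀ s < 0, ∀ t < 0, ∀ x,
      ‖iteratedFDeriv ℝ k (U t) x - iteratedFDeriv ℝ k (U s) x‖ ≤ L k * |t - s|) :
    (∀ t < 0, ContDiff ℝ ∞ fun y => curl (U t) y 1) ∧
    (∀ n : ℕ, ∀ t < 0, ∀ y, ‖iteratedFDeriv ℝ n (fun y => curl (U t) y 1) y‖ ≤ ‖curlCLM‖ * C (n + 1)) ∧
    (∀ n : ℕ, ∀ s < 0, ∀ t < 0, ∀ y,
      ‖iteratedFDeriv ℝ n (fun y => curl (U t) y 1) y - iteratedFDeriv ℝ n (fun y => curl (U s) y 1) y‖ ≤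
        ‖curlCLM‖ * L (n + 1) * |t - s|) := by
  set Λ : (EuclideanSpace ℝ (Fin 3) →L[ℝ] EuclideanSpace ℝ (Fin 3)) →L[ℝ] ℝ :=
    (EuclideanSpace.proj (1 : Fin 3) : EuclideanSpace ℝ (Fin 3) →L[ℝ] ℝ).comp curlCLM with hΛ_def
  have hΛ : ‖Λ‖ ≤ ‖curlCLM‖ := by
    refine (ContinuousLinearMap.opNorm_comp_le _ _).trans ?_
    have : ‖(EuclideanSpace.proj (1 : Fin 3) : EuclideanSpace ℝ (Fin 3) →L[ℝ] ℝ)‖ ≤ 1 :=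
      ContinuousLinearMap.opNorm_le_bound _ zero_le_one fun v => by
        rw [one_mul]; simpa using PiLp.norm_apply_le v 1
    calc _ ≤ 1 * ‖curlCLM‖ := mul_le_mul_of_nonneg_right this (norm_nonneg curlCLM)
      _ = ‖curlCLM‖ := one_mul _
  have heq : ∀ t, (fun y => curl (U t) y 1) = fun y => Λ (fderiv ℝ (U t) y) := fun t =>
    curl_apply_one_eq_clm (U t)
  refine ⟨fun t ht => ?_, fun n t ht y => ?_, fun n s hs t ht y => ?_⟩
  · rw [heq]; exact Λ.contDiff.comp ((hsmooth t ht).fderiv_right (m := ∞) le_rfl)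
  · rw [heq]
    calc _ ≤ ‖Λ‖ * ‖iteratedFDeriv ℝ (n + 1) (U t) y‖ :=
          norm_iteratedFDeriv_clm_apply_fderiv_le Λ (hsmooth t ht) n y
      _ ≤ ‖curlCLM‖ * C (n + 1) :=
          mul_le_mul hΛ (hC (n + 1) t ht y) (norm_nonneg _) (norm_nonneg curlCLM)
  · rw [heq, heq]
    have hdiff : (fun y => Λ (fderiv ℝ (U t) y)) - (fun y => Λ (fderiv ℝ (U s) y)) =
        fun y => Λ (fderiv ℝ (U t - U s) y) := by
      funext y
      rw [Pi.sub_apply, fderiv_sub (((hsmooth t ht).differentiable (by simp)) y)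
        (((hsmooth s hs).differentiable (by simp)) y), map_sub]
    have hts : ContDiff ℝ ∞ (U t - U s) := (hsmooth t ht).sub (hsmooth s hs)
    have hct : ContDiff ℝ n (fun y => Λ (fderiv ℝ (U t) y)) :=
      (Λ.contDiff.comp ((hsmooth t ht).fderiv_right (m := ∞) le_rfl)).of_le (natCast_le_contDiff_infty n)
    have hcs : ContDiff ℝ n (fun y => Λ (fderiv ℝ (U s) y)) :=
      (Λ.contDiff.comp ((hsmooth s hs).fderiv_right (m := ∞) le_rfl)).of_le (natCast_le_contDiff_infty n)
    rw [← iteratedFDeriv_sub_apply hct.contDiffAt hcs.contDiffAt, hdiff]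
    calc _ ≤ ‖Λ‖ * ‖iteratedFDeriv ℝ (n + 1) (U t - U s) y‖ :=
          norm_iteratedFDeriv_clm_apply_fderiv_le Λ hts n y
      _ = ‖Λ‖ * ‖iteratedFDeriv ℝ (n + 1) (U t) y - iteratedFDeriv ℝ (n + 1) (U s) y‖ := by
          rw [iteratedFDeriv_sub_apply ((hsmooth t ht).of_le (natCast_le_contDiff_infty _)).contDiffAt
            ((hsmooth s hs).of_le (natCast_le_contDiff_infty _)).contDiffAt]
      _ ≤ ‖curlCLM‖ * (L (n + 1) * |t - s|) :=
          mul_le_mul hΛ (hL (n + 1) (by omega) s hs t ht y) (norm_nonneg _) (norm_nonneg curlCLM)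
      _ = ‖curlCLM‖ * L (n + 1) * |t - s| := by ring

/-- **The scalar `f(t) = hadamardQuotFst (curl U(t))₁ = ω_θ / r` of the regular part**: smooth,
bounded with its derivatives uniformly in `t < 0`, and Lipschitz in `t` uniformly in `x`
together with the quantities entering the lift (`Df`, `∂ᵢ∂ᵢ f`, `hadamardQuotFst ∂₀ f`)
(KNSS 2009, Remark 5.1: "`f` is bounded together with its derivatives"). [cite: KochNadirashviliSereginSverak2009, Remark 5.1 and proof of Thm 5.2 (arXiv pp. 9–10)] -/
theorem scalar_family_regularity (hsmooth : ∀ t < 0, ContDiff ℝ ∞ (U t)) {C : ℕ → ℝ}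
    (hC : ∀ k : ℕ, ∀ t < 0, ∀ x, ‖iteratedFDeriv ℝ k (U t) x‖ ≤ C k) {L : ℕ → ℝ}
    (hL : ∀ k : ℕ, 1 ≤ k → ∀ s < 0, ∀ t < 0, ∀ x,
      ‖iteratedFDeriv ℝ k (U t) x - iteratedFDeriv ℝ k (U s) x‖ ≤ L k * |t - s|) :
    (∀ t < 0, ContDiff ℝ ∞ (hadamardQuotFst fun y => curl (U t) y 1)) ∧
    (∀ t < 0, ∀ x,
      |hadamardQuotFst (fun y => curl (U t) y 1) x| ≤ ‖curlCLM‖ * C 2 ∧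
      ‖fderiv ℝ (hadamardQuotFst fun y => curl (U t) y 1) x‖ ≤ ‖curlCLM‖ * C 3 ∧
      (∀ i : Fin 3, ‖fderiv ℝ (fun z => fderiv ℝ (hadamardQuotFst fun y => curl (U t) y 1) z
        (EuclideanSpace.single i 1)) x‖ ≤ ‖curlCLM‖ * C 4) ∧
      |hadamardQuotFst (fun z => fderiv ℝ (hadamardQuotFst fun y => curl (U t) y 1) z
        (EuclideanSpace.single 0 1)) x| ≤ ‖curlCLM‖ * C 4) ∧
    (∀ s < 0, ∀ t < 0, ∀ x,
      |hadamardQuotFst (fun y => curl (U t) y 1) x - hadamardQuotFst (fun y => curl (U s) y 1) x| ≤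
        ‖curlCLM‖ * L 2 * |t - s| ∧
      ‖fderiv ℝ (hadamardQuotFst fun y => curl (U t) y 1) x -
        fderiv ℝ (hadamardQuotFst fun y => curl (U s) y 1) x‖ ≤ ‖curlCLM‖ * L 3 * |t - s| ∧
      (∀ i : Fin 3, |fderiv ℝ (fun z => fderiv ℝ (hadamardQuotFst fun y => curl (U t) y 1) z
          (EuclideanSpace.single i 1)) x (EuclideanSpace.single i 1) -
        fderiv ℝ (fun z => fderiv ℝ (hadamardQuotFst fun y => curl (U s) y 1) z
          (EuclideanSpace.single i 1)) x (EuclideanSpace.single i 1)| ≤ ‖curlCLM‖ * L 4 * |t - s|) ∧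
      |hadamardQuotFst (fun z => fderiv ℝ (hadamardQuotFst fun y => curl (U t) y 1) z
          (EuclideanSpace.single 0 1)) x -
        hadamardQuotFst (fun z => fderiv ℝ (hadamardQuotFst fun y => curl (U s) y 1) z
          (EuclideanSpace.single 0 1)) x| ≤ ‖curlCLM‖ * L 4 * |t - s|) := by
  obtain ⟨hw, hwC, hwL⟩ := curl_apply_one_family hsmooth hC hL
  refine ⟨fun t ht => contDiff_hadamardQuotFst (hw t ht), fun t ht x => ?_, fun s hs t ht x => ?_⟩
  · obtain ⟨hD, hdir, hq⟩ := hadamardQuotFst_liftData_bounds (hw t ht) (hwC 2 t ht) (hwC 3 t ht) x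
    refine ⟨?_, hD, hdir, hq⟩
    have hB1 : ∀ y, ‖fderiv ℝ (fun y => curl (U t) y 1) y‖ ≤ ‖curlCLM‖ * C 2 := fun y => by
      rw [norm_fderiv_eq_norm_iteratedFDeriv_one]; exact hwC 1 t ht y
    have h := norm_hadamardQuotFst_le hB1 x
    rwa [Real.norm_eq_abs] at h
  · exact hadamardQuotFst_liftData_sub_bounds (hw t ht) (hw s hs) (hwL 1 s hs t ht) (hwL 2 s hs t ht)
      (hwL 3 s hs t ht) x

end Scalar

/-! ### The lifted family on `ℝ⁵`: continuity of the gradient and of the Laplacian -/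

section LiftFamily

/-- **Joint continuity of `D f̃` and `Δ f̃` on `(−∞, 0) × ℝ⁵`** for the lift `f̃(t) = liftAx (g t)`
of a family of smooth axisymmetric scalars whose lift data (`∂₂ g`, `∂ᵢ∂ᵢ g`,
`hadamardQuotFst ∂₀ g`) are Lipschitz in `t` uniformly in `x` (formulas `fderiv_liftAx`,
`laplacian_liftAx` of `AxisymmetricLiftR5`; uniform Lipschitz in time plus continuity in space
gives joint continuity). [folklore] -/
theorem liftAx_family_continuousOn {g : ℝ → EuclideanSpace ℝ (Fin 3) → ℝ}
    (hg : ∀ t < 0, ContDiff ℝ ∞ (g t)) (hax : ∀ t < 0, IsAxisymmetricScalar (g t)) {M : ℝ}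
    (hlip : ∀ s < 0, ∀ t < 0, ∀ x,
      ‖fderiv ℝ (g t) x - fderiv ℝ (g s) x‖ ≤ M * |t - s| ∧
      (∀ i : Fin 3, |fderiv ℝ (fun z => fderiv ℝ (g t) z (EuclideanSpace.single i 1)) x (EuclideanSpace.single i 1) -
        fderiv ℝ (fun z => fderiv ℝ (g s) z (EuclideanSpace.single i 1)) x (EuclideanSpace.single i 1)| ≤
          M * |t - s|) ∧
      |hadamardQuotFst (fun z => fderiv ℝ (g t) z (EuclideanSpace.single 0 1)) x -
        hadamardQuotFst (fun z => fderiv ℝ (g s) z (EuclideanSpace.single 0 1)) x| ≤ M * |t - s|) :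
    ContinuousOn (fun p : ℝ × EuclideanSpace ℝ (Fin 5) => fderiv ℝ (liftAx (g p.1)) p.2) (Iio 0 ×ˢ univ) ∧
    ContinuousOn (fun p : ℝ × EuclideanSpace ℝ (Fin 5) => (Δ (liftAx (g p.1))) p.2) (Iio 0 ×ˢ univ) := by
  have hev : ∀ t < 0, IsEvenC 0 (g t) := fun t ht => (hax t ht).isEvenC_zero
  have hg4 : ∀ t < 0, ContDiff ℝ 4 (g t) := fun t ht => (hg t ht).of_le (by norm_cast)
  have hg2 : ∀ t < 0, ContDiff ℝ 2 (g t) := fun t ht => (hg t ht).of_le (by norm_cast)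
  have h0 : ∀ t < 0, ∀ x : EuclideanSpace ℝ (Fin 3), x 0 = 0 →
      fderiv ℝ (g t) x (EuclideanSpace.single 0 1) = 0 := fun t ht x hx =>
    (hev t ht).fderiv_single_zero_eq_zero ((hg t ht).differentiable (by simp)) hx
  -- the four scalar quantities are jointly continuous on `(−∞, 0) × ℝ³`
  have hsm_d : ∀ t < 0, ∀ v, ContDiff ℝ ∞ fun z => fderiv ℝ (g t) z v := fun t ht v =>
    contDiff_infty_fderiv_apply (hg t ht) v
  have ψq : ContinuousOn (fun p : ℝ × EuclideanSpace ℝ (Fin 3) =>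
      hadamardQuotFst (fun z => fderiv ℝ (g p.1) z (EuclideanSpace.single 0 1)) p.2) (Iio 0 ×ˢ univ) :=
    continuousOn_prod_of_lipschitz_time
      (ψ := fun t x => hadamardQuotFst (fun z => fderiv ℝ (g t) z (EuclideanSpace.single 0 1)) x)
      (fun s hs t ht x => by rw [Real.norm_eq_abs]; exact (hlip s hs t ht x).2.2)
      (fun t ht => (contDiff_hadamardQuotFst (n := ⊤) (hsm_d t ht _)).continuous)
  have ψ2 : ContinuousOn (fun p : ℝ × EuclideanSpace ℝ (Fin 3) =>
      fderiv ℝ (g p.1) p.2 (EuclideanSpace.single 2 1)) (Iio 0 ×ˢ univ) :=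
    continuousOn_prod_of_lipschitz_time (ψ := fun t x => fderiv ℝ (g t) x (EuclideanSpace.single 2 1))
      (fun s hs t ht x => by
        rw [← _root_.sub_apply, Real.norm_eq_abs]
        have h := (fderiv ℝ (g t) x - fderiv ℝ (g s) x).le_opNorm (EuclideanSpace.single 2 (1 : ℝ))
        rw [PiLp.norm_single, norm_one, mul_one, Real.norm_eq_abs] at h
        exact h.trans (hlip s hs t ht x).1)
      (fun t ht => (hsm_d t ht _).continuous)
  have ψii : ∀ i : Fin 3, ContinuousOn (fun p : ℝ × EuclideanSpace ℝ (Fin 3) =>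
      fderiv ℝ (fun z => fderiv ℝ (g p.1) z (EuclideanSpace.single i 1)) p.2 (EuclideanSpace.single i 1))
      (Iio 0 ×ˢ univ) := fun i =>
    continuousOn_prod_of_lipschitz_time
      (ψ := fun t x => fderiv ℝ (fun z => fderiv ℝ (g t) z (EuclideanSpace.single i 1)) x (EuclideanSpace.single i 1))
      (fun s hs t ht x => by rw [Real.norm_eq_abs]; exact (hlip s hs t ht x).2.1 i)
      (fun t ht => (contDiff_infty_fderiv_apply (hsm_d t ht _) _).continuous)
  -- composition with `(t, y) ↦ (t, axisPt y)`
  have hA : Continuous fun p : ℝ × EuclideanSpace ℝ (Fin 5) => (p.1, axisPt p.2) :=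
    continuous_fst.prodMk (continuous_axisPt.comp continuous_snd)
  have hmaps : MapsTo (fun p : ℝ × EuclideanSpace ℝ (Fin 5) => (p.1, axisPt p.2)) (Iio 0 ×ˢ univ)
      (Iio (0 : ℝ) ×ˢ (univ : Set (EuclideanSpace ℝ (Fin 3)))) := fun p hp => ⟨hp.1, mem_univ _⟩
  have hP : Continuous fun p : ℝ × EuclideanSpace ℝ (Fin 5) => innerSL ℝ (horizProj p.2) :=
    (innerSL ℝ).continuous.comp (horizProj.continuous.comp continuous_snd)
  constructor
  · have hform : ContinuousOn (fun p : ℝ × EuclideanSpace ℝ (Fin 5) =>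
        hadamardQuotFst (fun z => fderiv ℝ (g p.1) z (EuclideanSpace.single 0 1)) (axisPt p.2) •
            innerSL ℝ (horizProj p.2) +
          fderiv ℝ (g p.1) (axisPt p.2) (EuclideanSpace.single 2 1) •
            (EuclideanSpace.proj (4 : Fin 5) : EuclideanSpace ℝ (Fin 5) →L[ℝ] ℝ)) (Iio 0 ×ˢ univ) :=
      ((ψq.comp hA.continuousOn hmaps).smul hP.continuousOn).add
        ((ψ2.comp hA.continuousOn hmaps).smul continuousOn_const)
    refine hform.congr fun p hp => ?_
    show fderiv ℝ (liftAx (g p.1)) p.2 = _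
    rw [fderiv_liftAx (hg2 p.1 hp.1) (h0 p.1 hp.1)]
    rfl
  · have hform : ContinuousOn (fun p : ℝ × EuclideanSpace ℝ (Fin 5) =>
        fderiv ℝ (fun z => fderiv ℝ (g p.1) z (EuclideanSpace.single 0 1)) (axisPt p.2) (EuclideanSpace.single 0 1) +
        fderiv ℝ (fun z => fderiv ℝ (g p.1) z (EuclideanSpace.single 2 1)) (axisPt p.2) (EuclideanSpace.single 2 1) +
        3 * hadamardQuotFst (fun z => fderiv ℝ (g p.1) z (EuclideanSpace.single 0 1)) (axisPt p.2))
        (Iio 0 ×ˢ univ) :=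
      (((ψii 0).comp hA.continuousOn hmaps).add ((ψii 2).comp hA.continuousOn hmaps)).add
        (continuousOn_const.mul (ψq.comp hA.continuousOn hmaps))
    refine hform.congr fun p hp => ?_
    exact laplacian_liftAx (hg4 p.1 hp.1) (hev p.1 hp.1) p.2

end LiftFamily

/-! ### The equation for the lift: from the vorticity equation to `f̃ₜ + ã·∇f̃ − Δ₅ f̃ = 0` -/

section Equation

variable {U : ℝ → EuclideanSpace ℝ (Fin 3) → EuclideanSpace ℝ (Fin 3)} {b : ℝ → EuclideanSpace ℝ (Fin 3)}

/-- Time continuity, at a fixed point and on `(−∞, 0)`, of `DU`, `curl U`, `D curl U`, `Δ curl U`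
for a family with derivatives Lipschitz in time (orders `≥ 1`). [folklore] -/
theorem continuousOn_vorticity_data (hsmooth : ∀ t < 0, ContDiff ℝ ∞ (U t)) {L : ℕ → ℝ}
    (hL : ∀ k : ℕ, 1 ≤ k → ∀ s < 0, ∀ t < 0, ∀ x,
      ‖iteratedFDeriv ℝ k (U t) x - iteratedFDeriv ℝ k (U s) x‖ ≤ L k * |t - s|)
    (x : EuclideanSpace ℝ (Fin 3)) :
    ContinuousOn (fun τ => fderiv ℝ (U τ) x) (Iio 0) ∧ ContinuousOn (fun τ => curl (U τ) x) (Iio 0) ∧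
    ContinuousOn (fun τ => fderiv ℝ (curl (U τ)) x) (Iio 0) ∧
    ContinuousOn (fun τ => (Δ (curl (U τ))) x) (Iio 0) := by
  have hD := lipschitz_fderiv_family_of_succ hL
  have hc1 : ContinuousOn (fun τ => fderiv ℝ (U τ) x) (Iio 0) :=
    continuousOn_apply_family (V := fun t => fderiv ℝ (U t)) hD x
  have hc2 : ContinuousOn (fun τ => fderiv ℝ (fderiv ℝ (U τ)) x) (Iio 0) :=
    continuousOn_fderiv_family (V := fun t => fderiv ℝ (U t)) hD x
  refine ⟨hc1, continuousOn_curl_of_lipschitz_succ hL x, ?_, ?_⟩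
  · have h3 : ContinuousOn (fun τ => curlCLM.comp (fderiv ℝ (fderiv ℝ (U τ)) x)) (Iio 0) :=
      continuousOn_const.clm_comp hc2
    refine h3.congr fun τ hτ => ?_
    exact fderiv_curl ((hsmooth τ hτ).of_le (by norm_cast)) x
  · set bs := stdOrthonormalBasis ℝ (EuclideanSpace ℝ (Fin 3)) with hbs
    have h3 : ContinuousOn (fun τ => iteratedFDeriv ℝ 2 (fderiv ℝ (U τ)) x) (Iio 0) :=
      continuousOn_iteratedFDeriv_family (V := fun t => fderiv ℝ (U t)) hD 2 x
    have hsum : ContinuousOn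
        (fun τ => ∑ i, iteratedFDeriv ℝ 2 (fderiv ℝ (U τ)) x ![bs i, bs i]) (Iio 0) :=
      continuousOn_finsetSum _ fun i _ =>
        (continuous_eval_const (![bs i, bs i] : Fin 2 → EuclideanSpace ℝ (Fin 3))).comp_continuousOn h3
    have hc : ContinuousOn
        (fun τ => curlCLM (∑ i, iteratedFDeriv ℝ 2 (fderiv ℝ (U τ)) x ![bs i, bs i])) (Iio 0) :=
      curlCLM.continuous.comp_continuousOn hsum
    refine hc.congr fun τ hτ => ?_
    have hft : ContDiff ℝ 2 (fderiv ℝ (U τ)) := (hsmooth τ hτ).fderiv_right (m := 2) (by norm_cast)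
    show Δ (curl (U τ)) x = curlCLM (∑ i, iteratedFDeriv ℝ 2 (fderiv ℝ (U τ)) x ![bs i, bs i])
    rw [curl_eq_curlCLM_comp, ContDiffAt.laplacian_CLM_comp_left hft.contDiffAt,
      Function.comp_apply, laplacian_eq_iteratedFDeriv_stdOrthonormalBasis]

/-- **The vorticity integrand of the §4 fact is interval integrable** on `[s, t] ⊂ (−∞, 0)`: the
diffusion and stretching terms are continuous in `τ`; the transport term pairs the continuous
`D curl U(τ)(x)` with the bounded measurable `U(τ, x) + b(τ)`. [folklore] -/
theorem vorticity_integrand_intervalIntegrable (hsmooth : ∀ t < 0, ContDiff ℝ ∞ (U t)) {C : ℕ → ℝ}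
    (hC : ∀ k : ℕ, ∀ t < 0, ∀ x, ‖iteratedFDeriv ℝ k (U t) x‖ ≤ C k) {L : ℕ → ℝ}
    (hL : ∀ k : ℕ, 1 ≤ k → ∀ s < 0, ∀ t < 0, ∀ x,
      ‖iteratedFDeriv ℝ k (U t) x - iteratedFDeriv ℝ k (U s) x‖ ≤ L k * |t - s|)
    (hUm : Measurable (uncurry U)) (hbm : Measurable b) {Cb : ℝ} (hCb : ∀ t, ‖b t‖ ≤ Cb)
    (x : EuclideanSpace ℝ (Fin 3)) {s t : ℝ} (hst : s ≤ t) (ht : t < 0) :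
    IntervalIntegrable (fun τ => (Δ (curl (U τ))) x - fderiv ℝ (curl (U τ)) x (U τ x + b τ) +
      fderiv ℝ (U τ) x (curl (U τ) x)) volume s t := by
  obtain ⟨hc1, hcω, hcDω, hcΔω⟩ := continuousOn_vorticity_data hsmooth hL x
  have hIcc : Icc s t ⊆ Iio 0 := fun τ hτ => hτ.2.trans_lt ht
  have hIoc : Ioc s t ⊆ Iio 0 := fun τ hτ => hτ.2.trans_lt ht
  have T1 : IntervalIntegrable (fun τ => (Δ (curl (U τ))) x) volume s t := by
    refine ContinuousOn.intervalIntegrable ?_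
    rw [uIcc_of_le hst]; exact hcΔω.mono hIcc
  have T3 : IntervalIntegrable (fun τ => fderiv ℝ (U τ) x (curl (U τ) x)) volume s t := by
    refine ContinuousOn.intervalIntegrable ?_
    rw [uIcc_of_le hst]; exact (hc1.clm_apply hcω).mono hIcc
  have T2 : IntervalIntegrable (fun τ => fderiv ℝ (curl (U τ)) x (U τ x + b τ)) volume s t := by
    have hmeas : AEStronglyMeasurable (fun τ => fderiv ℝ (curl (U τ)) x (U τ x + b τ))
        (volume.restrict (Ioc s t)) := by
      have h1 : AEStronglyMeasurable (fun τ => fderiv ℝ (curl (U τ)) x) (volume.restrict (Ioc s t)) :=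
        (hcDω.mono hIoc).aestronglyMeasurable measurableSet_Ioc
      have h2 : AEStronglyMeasurable (fun τ => U τ x + b τ) (volume.restrict (Ioc s t)) :=
        ((hUm.comp (measurable_id.prodMk measurable_const)).add hbm).aestronglyMeasurable
      exact (isBoundedBilinearMap_apply (𝕜 := ℝ) (E := EuclideanSpace ℝ (Fin 3))
        (F := EuclideanSpace ℝ (Fin 3))).continuous.comp_aestronglyMeasurable (h1.prodMk h2)
    have hbound : ∀ τ ∈ Ioc s t, ‖fderiv ℝ (curl (U τ)) x (U τ x + b τ)‖ ≤ ‖curlCLM‖ * C 2 * (C 0 + Cb) := by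
      intro τ hτ
      have hτ0 : τ < 0 := hIoc hτ
      have h2 : ContDiff ℝ 2 (U τ) := (hsmooth τ hτ0).of_le (by norm_cast)
      have hn1 : ‖fderiv ℝ (curl (U τ)) x‖ ≤ ‖curlCLM‖ * C 2 := by
        rw [fderiv_curl h2 x]
        refine (ContinuousLinearMap.opNorm_comp_le _ _).trans ?_
        rw [norm_fderiv_fderiv_eq_norm_iteratedFDeriv_two]
        exact mul_le_mul_of_nonneg_left (hC 2 τ hτ0 x) (norm_nonneg curlCLM)
      have hn2 : ‖U τ x + b τ‖ ≤ C 0 + Cb := by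
        refine (norm_add_le _ _).trans (add_le_add ?_ (hCb τ))
        have h := hC 0 τ hτ0 x
        rwa [norm_iteratedFDeriv_zero] at h
      have h0 : 0 ≤ ‖curlCLM‖ * C 2 := le_trans (norm_nonneg (fderiv ℝ (curl (U τ)) x)) hn1
      calc _ ≤ ‖fderiv ℝ (curl (U τ)) x‖ * ‖U τ x + b τ‖ := ContinuousLinearMap.le_opNorm _ _
        _ ≤ ‖curlCLM‖ * C 2 * (C 0 + Cb) := mul_le_mul hn1 hn2 (norm_nonneg _) h0
    rw [intervalIntegrable_iff_integrableOn_Ioc_of_le hst]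
    refine (integrable_const (‖curlCLM‖ * C 2 * (C 0 + Cb))).mono' hmeas ?_
    exact (ae_restrict_iff' measurableSet_Ioc).2 (ae_of_all _ hbound)
  exact (T1.sub T2).add T3

/-- **The lift `f̃(t) = liftAx f(t)` solves `f̃ₜ + ã·∇_y f̃ − Δ_y f̃ = 0` in integrated form**
(KNSS 2009, proof of Theorem 5.2, p. 10: (5.10) for `f = ω_θ / r`, whose diffusion part
`Δf + (2/r) f_r` "can be interpreted as the 5-dimensional Laplacian", so that "Lemma 2.1 can be
applied"). Here `f(τ) = hadamardQuotFst (curl U(τ))₁`, the drift is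
`ã(τ, y) = u_r P y/|P y| + u_z e₄` with `(u_r, u_z)` the components of
`u(τ) = U(τ) + b(τ)` at the meridian point `axisPt y`, and the hypotheses are the clauses of the
§4 fact together with the a.e. axisymmetry/no-swirl of `U + b` and the structure of the
vorticity. The identity is first obtained with the weight `r² = |P y|²` from the scalar equation
(`integral_scalarEq_of_vorticityEq`) and the lift formulas (`sq_mul_laplacian_liftAx`,
`liftDeriv_apply_drift`), then extended across the axis `{P y = 0}` by continuity in `y`
(dominated convergence for the time integral). [cite: KochNadirashviliSereginSverak2009, proof of Thm 5.2 (arXiv p. 10) with (5.10)–(5.12) p. 9] -/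
theorem liftAx_equation (hsmooth : ∀ t < 0, ContDiff ℝ ∞ (U t)) {C : ℕ → ℝ}
    (hC : ∀ k : ℕ, ∀ t < 0, ∀ x, ‖iteratedFDeriv ℝ k (U t) x‖ ≤ C k) {L : ℕ → ℝ}
    (hL : ∀ k : ℕ, 1 ≤ k → ∀ s < 0, ∀ t < 0, ∀ x,
      ‖iteratedFDeriv ℝ k (U t) x - iteratedFDeriv ℝ k (U s) x‖ ≤ L k * |t - s|)
    (hUm : Measurable (uncurry U)) (hbm : Measurable b) {Cb : ℝ} (hCb : ∀ t, ‖b t‖ ≤ Cb)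
    (hvort : ∀ x, ∀ s t : ℝ, s ≤ t → t < 0 →
      curl (U t) x - curl (U s) x =
        ∫ τ in s..t, ((Δ (curl (U τ))) x - fderiv ℝ (curl (U τ)) x (U τ x + b τ) +
          fderiv ℝ (U τ) x (curl (U τ) x)))
    (hgood : ∀ᵐ t ∂((volume : Measure ℝ).restrict (Iio 0)),
      IsAxisymmetric (fun x => U t x + b t) ∧ HasNoSwirl (fun x => U t x + b t))
    (hstr : ∀ t < 0, (∀ x : EuclideanSpace ℝ (Fin 3), curl (U t) x 2 = 0) ∧
      (∀ x : EuclideanSpace ℝ (Fin 3), x 0 * curl (U t) x 0 + x 1 * curl (U t) x 1 = 0) ∧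
      IsAxisymmetric (curl (U t)))
    (y : EuclideanSpace ℝ (Fin 5)) {s t : ℝ} (hst : s ≤ t) (ht : t < 0) :
    liftAx (hadamardQuotFst fun z => curl (U t) z 1) y - liftAx (hadamardQuotFst fun z => curl (U s) z 1) y =
      ∫ τ in s..t, ((Δ (liftAx (hadamardQuotFst fun z => curl (U τ) z 1))) y -
        fderiv ℝ (liftAx (hadamardQuotFst fun z => curl (U τ) z 1)) y
          ((U τ (axisPt y) + b τ) 0 • (‖horizProj y‖⁻¹ • horizProj y) +
            (U τ (axisPt y) + b τ) 2 • EuclideanSpace.single 4 (1 : ℝ))) := by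
  -- notation and regularity
  set f : ℝ → EuclideanSpace ℝ (Fin 3) → ℝ := fun τ => hadamardQuotFst fun z => curl (U τ) z 1 with hf_def
  obtain ⟨hf, hfB, hfL⟩ := scalar_family_regularity hsmooth hC hL
  have hfax : ∀ τ < 0, IsAxisymmetricScalar (f τ) := fun τ hτ =>
    isAxisymmetricScalar_of_curl_structure (hstr τ hτ).2.2 ((hsmooth τ hτ).of_le (by norm_cast))
      (hstr τ hτ).1 (hstr τ hτ).2.1
  have hev : ∀ τ < 0, IsEvenC 0 (f τ) := fun τ hτ => (hfax τ hτ).isEvenC_zero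
  have hf4 : ∀ τ < 0, ContDiff ℝ 4 (f τ) := fun τ hτ => (hf τ hτ).of_le (by norm_cast)
  have hf2 : ∀ τ < 0, ContDiff ℝ 2 (f τ) := fun τ hτ => (hf τ hτ).of_le (by norm_cast)
  have hfd : ∀ τ < 0, Differentiable ℝ (f τ) := fun τ hτ => (hf τ hτ).differentiable (by simp)
  have h0 : ∀ τ < 0, ∀ x : EuclideanSpace ℝ (Fin 3), x 0 = 0 →
      fderiv ℝ (f τ) x (EuclideanSpace.single 0 1) = 0 := fun τ hτ x hx =>
    (hev τ hτ).fderiv_single_zero_eq_zero (hfd τ hτ) hx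
  have h1 : ∀ τ < 0, ∀ x : EuclideanSpace ℝ (Fin 3), x 1 = 0 →
      fderiv ℝ (f τ) x (EuclideanSpace.single 1 1) = 0 := fun τ hτ x hx =>
    (hfax τ hτ).isEvenC_one.fderiv_single_one_eq_zero (hfd τ hτ) hx
  -- the pointwise form of the integrand for `τ < 0`
  have hform : ∀ τ < 0, ∀ y' : EuclideanSpace ℝ (Fin 5),
      (Δ (liftAx (f τ))) y' - fderiv ℝ (liftAx (f τ)) y'
        ((U τ (axisPt y') + b τ) 0 • (‖horizProj y'‖⁻¹ • horizProj y') +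
          (U τ (axisPt y') + b τ) 2 • EuclideanSpace.single 4 (1 : ℝ)) =
      fderiv ℝ (fun z => fderiv ℝ (f τ) z (EuclideanSpace.single 0 1)) (axisPt y') (EuclideanSpace.single 0 1) +
        fderiv ℝ (fun z => fderiv ℝ (f τ) z (EuclideanSpace.single 2 1)) (axisPt y') (EuclideanSpace.single 2 1) +
        3 * hadamardQuotFst (fun z => fderiv ℝ (f τ) z (EuclideanSpace.single 0 1)) (axisPt y') -
        fderiv ℝ (f τ) (axisPt y') (U τ (axisPt y') + b τ) := by
    intro τ hτ y'
    rw [laplacian_liftAx (hf4 τ hτ) (hev τ hτ) y', fderiv_liftAx (hf2 τ hτ) (h0 τ hτ) y',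
      liftDeriv_apply_drift (hf2 τ hτ) (h0 τ hτ) (h1 τ hτ) y' (U τ (axisPt y') + b τ)]
  -- Step 1: the identity with the weight `|P y'|²`, for every `y'`
  have hweighted : ∀ y' : EuclideanSpace ℝ (Fin 5),
      ‖horizProj y'‖ ^ 2 * ((liftAx (f t) y' - liftAx (f s) y') -
        ∫ τ in s..t, ((Δ (liftAx (f τ))) y' - fderiv ℝ (liftAx (f τ)) y'
          ((U τ (axisPt y') + b τ) 0 • (‖horizProj y'‖⁻¹ • horizProj y') +
            (U τ (axisPt y') + b τ) 2 • EuclideanSpace.single 4 (1 : ℝ)))) = 0 := by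
    intro y'
    have hU4 : ∀ τ ∈ Icc s t, ContDiff ℝ 4 (U τ) := fun τ hτ =>
      (hsmooth τ (hτ.2.trans_lt ht)).of_le (by norm_cast)
    have h2' : ∀ τ ∈ Icc s t, ∀ z : EuclideanSpace ℝ (Fin 3), curl (U τ) z 2 = 0 := fun τ hτ =>
      (hstr τ (hτ.2.trans_lt ht)).1
    have hb' : ∀ τ ∈ Icc s t, ∀ z : EuclideanSpace ℝ (Fin 3),
        z 0 * curl (U τ) z 0 + z 1 * curl (U τ) z 1 = 0 := fun τ hτ => (hstr τ (hτ.2.trans_lt ht)).2.1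
    have hax' : ∀ᵐ τ ∂(volume : Measure ℝ), τ ∈ Ioo s t →
        fderiv ℝ (U τ) (axisPt y') (rotGen (axisPt y')) = rotGen (U τ (axisPt y') + b τ) := by
      have h := (ae_restrict_iff' (measurableSet_Iio (a := (0 : ℝ)))).1 hgood
      filter_upwards [h] with τ hτ hτI
      have hτ0 : τ < 0 := hτI.2.trans ht
      obtain ⟨hA, -⟩ := hτ hτ0
      have hd : DifferentiableAt ℝ (fun z => U τ z + b τ) (axisPt y') :=
        (((hsmooth τ hτ0).differentiable (by simp)) (axisPt y')).add_const _
      have h' := hA.fderiv_rotGen hd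
      rwa [fderiv_add_const] at h'
    have hint := vorticity_integrand_intervalIntegrable hsmooth hC hL hUm hbm hCb (axisPt y') hst ht
    have hB2 := integral_scalarEq_of_vorticityEq hst hU4 h2' hb' hax' hint (hvort (axisPt y') s t hst ht)
    -- rewrite the integrand through the lift
    have hI : ∀ τ ∈ uIcc s t,
        (axisPt y' 0 ^ 2 + axisPt y' 1 ^ 2) * ((Δ (f τ)) (axisPt y') -
            fderiv ℝ (f τ) (axisPt y') (U τ (axisPt y') + b τ)) +
          2 * (axisPt y' 0 * fderiv ℝ (f τ) (axisPt y') (EuclideanSpace.single 0 1) +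
            axisPt y' 1 * fderiv ℝ (f τ) (axisPt y') (EuclideanSpace.single 1 1)) =
        (axisPt y' 0 ^ 2 + axisPt y' 1 ^ 2) * ((Δ (liftAx (f τ))) y' - fderiv ℝ (liftAx (f τ)) y'
          ((U τ (axisPt y') + b τ) 0 • (‖horizProj y'‖⁻¹ • horizProj y') +
            (U τ (axisPt y') + b τ) 2 • EuclideanSpace.single 4 (1 : ℝ))) := by
      intro τ hτ
      rw [uIcc_of_le hst] at hτ
      have hτ0 : τ < 0 := hτ.2.trans_lt ht
      have hS := sq_mul_laplacian_liftAx (hf4 τ hτ0) (hfax τ hτ0) y'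
      rw [fderiv_liftAx (hf2 τ hτ0) (h0 τ hτ0) y',
        liftDeriv_apply_drift (hf2 τ hτ0) (h0 τ hτ0) (h1 τ hτ0) y' (U τ (axisPt y') + b τ)]
      linear_combination (-1 : ℝ) * hS
    rw [intervalIntegral.integral_congr hI, intervalIntegral.integral_const_mul] at hB2
    have hr2 : axisPt y' 0 ^ 2 + axisPt y' 1 ^ 2 = ‖horizProj y'‖ ^ 2 := by
      rw [axisPt_apply_zero, axisPt_apply_one]; ring
    rw [← hr2]
    have hval : ∀ τ, liftAx (f τ) y' = f τ (axisPt y') := fun τ => rfl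
    rw [hval, hval]
    linear_combination hB2
  -- Step 2: both sides are continuous in `y`; conclude across the axis
  have hIoc : Ioc s t ⊆ Iio 0 := fun τ hτ => hτ.2.trans_lt ht
  have hLHS : Continuous fun y' : EuclideanSpace ℝ (Fin 5) => liftAx (f t) y' - liftAx (f s) y' :=
    (continuous_liftAx (hf t ht).continuous).sub (continuous_liftAx (hf s (hst.trans_lt ht)).continuous)
  have hRHS : Continuous fun y' : EuclideanSpace ℝ (Fin 5) =>
      ∫ τ in s..t, ((Δ (liftAx (f τ))) y' - fderiv ℝ (liftAx (f τ)) y'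
        ((U τ (axisPt y') + b τ) 0 • (‖horizProj y'‖⁻¹ • horizProj y') +
          (U τ (axisPt y') + b τ) 2 • EuclideanSpace.single 4 (1 : ℝ))) := by
    refine intervalIntegral.continuous_of_dominated_interval
      (bound := fun _ => 5 * (‖curlCLM‖ * C 4) + ‖curlCLM‖ * C 3 * (C 0 + Cb)) ?_ ?_
      intervalIntegrable_const ?_
    · -- measurability in `τ` on `Ι s t = Ioc s t`
      intro y'
      rw [uIoc_of_le hst]
      set x' : EuclideanSpace ℝ (Fin 3) := axisPt y' with hx'_def
      -- the explicit formula is measurable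
      have hmii : ∀ i : Fin 3, AEStronglyMeasurable (fun τ => fderiv ℝ (fun z => fderiv ℝ (f τ) z
          (EuclideanSpace.single i 1)) x' (EuclideanSpace.single i 1)) (volume.restrict (Ioc s t)) := by
        intro i
        refine (ContinuousOn.mono ?_ hIoc).aestronglyMeasurable measurableSet_Ioc
        exact continuousOn_of_norm_sub_le_mul fun s' hs' t' ht' => by
          rw [Real.norm_eq_abs]; exact (hfL s' hs' t' ht' x').2.2.1 i
      have hmq : AEStronglyMeasurable (fun τ => hadamardQuotFst (fun z => fderiv ℝ (f τ) z
          (EuclideanSpace.single 0 1)) x') (volume.restrict (Ioc s t)) := by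
        refine (ContinuousOn.mono ?_ hIoc).aestronglyMeasurable measurableSet_Ioc
        exact continuousOn_of_norm_sub_le_mul fun s' hs' t' ht' => by
          rw [Real.norm_eq_abs]; exact (hfL s' hs' t' ht' x').2.2.2
      have hmD : AEStronglyMeasurable (fun τ => fderiv ℝ (f τ) x') (volume.restrict (Ioc s t)) := by
        refine (ContinuousOn.mono ?_ hIoc).aestronglyMeasurable measurableSet_Ioc
        exact continuousOn_of_norm_sub_le_mul fun s' hs' t' ht' => (hfL s' hs' t' ht' x').2.1
      have hmc : AEStronglyMeasurable (fun τ => U τ x' + b τ) (volume.restrict (Ioc s t)) :=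
        ((hUm.comp (measurable_id.prodMk measurable_const)).add hbm).aestronglyMeasurable
      have hmpair : AEStronglyMeasurable (fun τ => fderiv ℝ (f τ) x' (U τ x' + b τ))
          (volume.restrict (Ioc s t)) :=
        (isBoundedBilinearMap_apply (𝕜 := ℝ) (E := EuclideanSpace ℝ (Fin 3)) (F := ℝ)).continuous
          |>.comp_aestronglyMeasurable (hmD.prodMk hmc)
      have hmeasΦ : AEStronglyMeasurable (fun τ =>
          fderiv ℝ (fun z => fderiv ℝ (f τ) z (EuclideanSpace.single 0 1)) x' (EuclideanSpace.single 0 1) +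
          fderiv ℝ (fun z => fderiv ℝ (f τ) z (EuclideanSpace.single 2 1)) x' (EuclideanSpace.single 2 1) +
          3 * hadamardQuotFst (fun z => fderiv ℝ (f τ) z (EuclideanSpace.single 0 1)) x' -
          fderiv ℝ (f τ) x' (U τ x' + b τ)) (volume.restrict (Ioc s t)) :=
        (((hmii 0).add (hmii 2)).add ((aestronglyMeasurable_const (b := (3 : ℝ))).mul hmq)).sub hmpair
      refine hmeasΦ.congr ?_
      refine (ae_restrict_iff' measurableSet_Ioc).2 (ae_of_all _ fun τ hτ => ?_)
      exact (hform τ (hIoc hτ) y').symm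
    · -- uniform bound
      intro y'
      refine ae_of_all _ fun τ hτ => ?_
      rw [uIoc_of_le hst] at hτ
      have hτ0 : τ < 0 := hIoc hτ
      rw [hform τ hτ0 y', Real.norm_eq_abs]
      obtain ⟨-, hD, hdir, hq⟩ := hfB τ hτ0 (axisPt y')
      have e00 := (abs_fderiv_apply_single_le (w := fun z => fderiv ℝ (f τ) z (EuclideanSpace.single 0 1))
        (axisPt y') 0).trans (hdir 0)
      have e22 := (abs_fderiv_apply_single_le (w := fun z => fderiv ℝ (f τ) z (EuclideanSpace.single 2 1))
        (axisPt y') 2).trans (hdir 2)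
      have hc' : ‖U τ (axisPt y') + b τ‖ ≤ C 0 + Cb := by
        refine (norm_add_le _ _).trans (add_le_add ?_ (hCb τ))
        have h := hC 0 τ hτ0 (axisPt y')
        rwa [norm_iteratedFDeriv_zero] at h
      have epair : |fderiv ℝ (f τ) (axisPt y') (U τ (axisPt y') + b τ)| ≤ ‖curlCLM‖ * C 3 * (C 0 + Cb) := by
        rw [← Real.norm_eq_abs]
        refine (ContinuousLinearMap.le_opNorm _ _).trans ?_
        exact mul_le_mul hD hc' (norm_nonneg _) ((norm_nonneg _).trans hD)
      have hq' : |3 * hadamardQuotFst (fun z => fderiv ℝ (f τ) z (EuclideanSpace.single 0 1)) (axisPt y')| ≤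
          3 * (‖curlCLM‖ * C 4) := by
        rw [abs_mul, abs_of_pos (by norm_num : (0 : ℝ) < 3)]; exact mul_le_mul_of_nonneg_left hq (by norm_num)
      calc _ ≤ |fderiv ℝ (fun z => fderiv ℝ (f τ) z (EuclideanSpace.single 0 1)) (axisPt y') (EuclideanSpace.single 0 1) +
            fderiv ℝ (fun z => fderiv ℝ (f τ) z (EuclideanSpace.single 2 1)) (axisPt y') (EuclideanSpace.single 2 1) +
            3 * hadamardQuotFst (fun z => fderiv ℝ (f τ) z (EuclideanSpace.single 0 1)) (axisPt y')| +
            |fderiv ℝ (f τ) (axisPt y') (U τ (axisPt y') + b τ)| := abs_sub _ _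
        _ ≤ (‖curlCLM‖ * C 4 + ‖curlCLM‖ * C 4 + 3 * (‖curlCLM‖ * C 4)) + ‖curlCLM‖ * C 3 * (C 0 + Cb) := by
            gcongr
            exact (abs_add_le _ _).trans (add_le_add ((abs_add_le _ _).trans (add_le_add e00 e22)) hq')
        _ = 5 * (‖curlCLM‖ * C 4) + ‖curlCLM‖ * C 3 * (C 0 + Cb) := by ring
    · -- continuity in `y` for `τ ∈ Ι s t`
      refine ae_of_all _ fun τ hτ => ?_
      rw [uIoc_of_le hst] at hτ
      have hτ0 : τ < 0 := hIoc hτ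
      have heq : (fun y' : EuclideanSpace ℝ (Fin 5) => (Δ (liftAx (f τ))) y' - fderiv ℝ (liftAx (f τ)) y'
          ((U τ (axisPt y') + b τ) 0 • (‖horizProj y'‖⁻¹ • horizProj y') +
            (U τ (axisPt y') + b τ) 2 • EuclideanSpace.single 4 (1 : ℝ))) =
          fun y' => fderiv ℝ (fun z => fderiv ℝ (f τ) z (EuclideanSpace.single 0 1)) (axisPt y')
              (EuclideanSpace.single 0 1) +
            fderiv ℝ (fun z => fderiv ℝ (f τ) z (EuclideanSpace.single 2 1)) (axisPt y') (EuclideanSpace.single 2 1) +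
            3 * hadamardQuotFst (fun z => fderiv ℝ (f τ) z (EuclideanSpace.single 0 1)) (axisPt y') -
            fderiv ℝ (f τ) (axisPt y') (U τ (axisPt y') + b τ) := funext (hform τ hτ0)
      rw [heq]
      have hsm : ∀ v, ContDiff ℝ ∞ fun z => fderiv ℝ (f τ) z v := fun v => contDiff_infty_fderiv_apply (hf τ hτ0) v
      have hcii : ∀ i : Fin 3, Continuous fun y' : EuclideanSpace ℝ (Fin 5) =>
          fderiv ℝ (fun z => fderiv ℝ (f τ) z (EuclideanSpace.single i 1)) (axisPt y') (EuclideanSpace.single i 1) :=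
        fun i => (contDiff_infty_fderiv_apply (hsm _) _).continuous.comp continuous_axisPt
      have hcq : Continuous fun y' : EuclideanSpace ℝ (Fin 5) =>
          hadamardQuotFst (fun z => fderiv ℝ (f τ) z (EuclideanSpace.single 0 1)) (axisPt y') :=
        (contDiff_hadamardQuotFst (n := ⊤) (hsm _)).continuous.comp continuous_axisPt
      have hcp : Continuous fun y' : EuclideanSpace ℝ (Fin 5) => fderiv ℝ (f τ) (axisPt y') (U τ (axisPt y') + b τ) :=
        (((hf τ hτ0).continuous_fderiv (by simp)).comp continuous_axisPt).clm_apply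
          (((hsmooth τ hτ0).continuous.comp continuous_axisPt).add continuous_const)
      exact (((hcii 0).add (hcii 2)).add (continuous_const.mul hcq)).sub hcp
  have hP : ∃ v : EuclideanSpace ℝ (Fin 5), horizProj v ≠ 0 :=
    ⟨EuclideanSpace.single 0 1, by rw [horizProj_single_of_ne (by decide)]; simp⟩
  refine eq_of_eq_off_ker horizProj hP hLHS hRHS (fun z hz => ?_) y
  have hne : ‖horizProj z‖ ^ 2 ≠ 0 := pow_ne_zero 2 (norm_ne_zero_iff.2 hz)
  exact sub_eq_zero.1 ((mul_eq_zero.1 (hweighted z)).resolve_left hne)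

end Equation

/-! ### Assembly -/

section Assembly

/-- The point `(r, 0, 0, 0, z) ∈ ℝ⁵` above `x ∈ ℝ³` (`r = cylRadius x`, `z = x₂`) has meridian
point `meridianPoint (meridian x)`; so every value of an axisymmetric scalar is a value of its
lift. [folklore] -/
theorem axisPt_lift_point (x : EuclideanSpace ℝ (Fin 3)) :
    axisPt ((cylRadius x) • EuclideanSpace.single 0 (1 : ℝ) + (x 2) • EuclideanSpace.single 4 (1 : ℝ) :
      EuclideanSpace ℝ (Fin 5)) = meridianPoint (meridian x) := by
  have hP : horizProj ((cylRadius x) • EuclideanSpace.single 0 (1 : ℝ) + (x 2) • EuclideanSpace.single 4 (1 : ℝ) :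
      EuclideanSpace ℝ (Fin 5)) = (cylRadius x) • EuclideanSpace.single 0 (1 : ℝ) := by
    rw [map_add, map_smul, map_smul, horizProj_single_of_ne (by decide), horizProj_single_four, smul_zero,
      add_zero]
  unfold axisPt
  rw [meridian_apply, hP, norm_smul, PiLp.norm_single, norm_one, mul_one, Real.norm_eq_abs,
    abs_of_nonneg (cylRadius_nonneg x)]
  congr 1
  refine Prod.ext rfl ?_
  simp

/-- **The vorticity of the regular part vanishes** (KNSS 2009, proof of Theorem 5.2, p. 10, up to
"Hence `ω_θ` vanishes identically. For axi-symmetric vector fields with no swirl this means that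
`ω = 0`"). Given the output `(U, b)` of the §4 fact for a bounded ancient weak solution `u`
which is axisymmetric and swirl free in the `L^∞` sense, and Lemma 2.1 on `ℝ⁵`
(`KNSS2009_lemma21_halfball`), `curl U(t) = 0` for every `t < 0`: `U + b` is axisymmetric
and swirl free for a.e. `t` (`ae_isAxisymmetric_hasNoSwirl_repr`, `KNSSThm52GoodTimes`), so `curl U(t) = f(t) J`
with `f(t)` an axisymmetric smooth scalar for every `t < 0` (`curl_structure_of_ae`); the lift
`f̃` is in the class of Lemma 2.1 (`liftAx_family_continuousOn`, `liftAx_equation`, the bounds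
of `scalar_family_regularity` and `AxisymmetricLiftR5`) and `|y₀| |f̃| ≤ r |f| = |ω| ≤ C₁`, so
`f̃ = 0` (`KNSS2009_lemma21_halfball.eq_zero_of_abs_mul_le`), hence `f = 0` and `ω = f J = 0`.
[cite: KochNadirashviliSereginSverak2009, Thm 5.2 and its proof (arXiv pp. 9–10)] -/
theorem curl_eq_zero_of_KNSS2009_facts (hball : KNSS2009_lemma21_halfball (EuclideanSpace ℝ (Fin 5)))
    {u U : ℝ → EuclideanSpace ℝ (Fin 3) → EuclideanSpace ℝ (Fin 3)} {b : ℝ → EuclideanSpace ℝ (Fin 3)}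
    (hrot : ∀ θ : ℝ, ∀ᵐ t ∂((volume : Measure ℝ).restrict (Iio 0)),
      (fun x => u t (rotZ θ x)) =ᵐ[volume] fun x => rotZ θ (u t x))
    (hsw : ∀ᵐ t ∂((volume : Measure ℝ).restrict (Iio 0)),
      swirl (u t) =ᵐ[volume] (0 : EuclideanSpace ℝ (Fin 3) → ℝ))
    (hbm : Measurable b) (hbC : ∃ C : ℝ, ∀ t, ‖b t‖ ≤ C) (hUm : Measurable (uncurry U))
    (hae : ∀ᵐ t ∂((volume : Measure ℝ).restrict (Iio 0)), u t =ᵐ[volume] fun x => U t x + b t)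
    (hsmooth : ∀ t < 0, ContDiff ℝ ∞ (U t))
    (hbd : ∀ k : ℕ, ∃ C : ℝ, ∀ t < 0, ∀ x, ‖iteratedFDeriv ℝ k (U t) x‖ ≤ C)
    (hlip : ∀ k : ℕ, 1 ≤ k → ∃ L : ℝ, ∀ s < 0, ∀ t < 0, ∀ x,
      ‖iteratedFDeriv ℝ k (U t) x - iteratedFDeriv ℝ k (U s) x‖ ≤ L * |t - s|)
    (hvort : ∀ x, ∀ s t : ℝ, s ≤ t → t < 0 →
      curl (U t) x - curl (U s) x =
        ∫ τ in s..t, ((Δ (curl (U τ))) x - fderiv ℝ (curl (U τ)) x (U τ x + b τ) +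
          fderiv ℝ (U τ) x (curl (U τ) x))) :
    ∀ t < 0, ∀ x, curl (U t) x = 0 := by
  choose C hC using hbd
  choose! L hL using hlip
  obtain ⟨Cb, hCb⟩ := hbC
  have hgood := ae_isAxisymmetric_hasNoSwirl_repr hrot hsw hae fun t ht => (hsmooth t ht).continuous
  have hstr := curl_structure_of_ae hsmooth hL hgood
  set f : ℝ → EuclideanSpace ℝ (Fin 3) → ℝ := fun τ => hadamardQuotFst fun z => curl (U τ) z 1 with hf_def
  obtain ⟨hf, hfB, hfL⟩ := scalar_family_regularity hsmooth hC hL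
  have hfax : ∀ τ < 0, IsAxisymmetricScalar (f τ) := fun τ hτ =>
    isAxisymmetricScalar_of_curl_structure (hstr τ hτ).2.2 ((hsmooth τ hτ).of_le (by norm_cast))
      (hstr τ hτ).1 (hstr τ hτ).2.1
  have hev : ∀ τ < 0, IsEvenC 0 (f τ) := fun τ hτ => (hfax τ hτ).isEvenC_zero
  have hf4 : ∀ τ < 0, ContDiff ℝ 4 (f τ) := fun τ hτ => (hf τ hτ).of_le (by norm_cast)
  have hf2 : ∀ τ < 0, ContDiff ℝ 2 (f τ) := fun τ hτ => (hf τ hτ).of_le (by norm_cast)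
  have h0 : ∀ τ < 0, ∀ x : EuclideanSpace ℝ (Fin 3), x 0 = 0 →
      fderiv ℝ (f τ) x (EuclideanSpace.single 0 1) = 0 := fun τ hτ x hx =>
    (hev τ hτ).fderiv_single_zero_eq_zero ((hf τ hτ).differentiable (by simp)) hx
  have hcurl : ∀ t < 0, ∀ x, curl (U t) x = f t x • rotGen x := fun t ht x =>
    eq_hadamardQuotFst_smul_rotGen
      (contDiff_curl (n := 1) (by exact_mod_cast ((hsmooth t ht).of_le (by norm_cast) : ContDiff ℝ 2 (U t))))
      (hstr t ht).1 (hstr t ht).2.1 x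
  -- the lifted family and the drift
  set F : ℝ → EuclideanSpace ℝ (Fin 5) → ℝ := fun τ y => liftAx (f τ) y with hF_def
  set a : ℝ → EuclideanSpace ℝ (Fin 5) → EuclideanSpace ℝ (Fin 5) := fun τ y =>
    (U τ (axisPt y) + b τ) 0 • (‖horizProj y‖⁻¹ • horizProj y) +
      (U τ (axisPt y) + b τ) 2 • EuclideanSpace.single 4 (1 : ℝ) with ha_def
  -- the hypotheses of Lemma 2.1 (half-ball form)
  have ha_meas : Measurable (uncurry a) := by
    have hc : Measurable fun p : ℝ × EuclideanSpace ℝ (Fin 5) => U p.1 (axisPt p.2) + b p.1 :=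
      (hUm.comp (measurable_fst.prodMk (continuous_axisPt.measurable.comp measurable_snd))).add
        (hbm.comp measurable_fst)
    have h0c : Measurable fun p : ℝ × EuclideanSpace ℝ (Fin 5) => (U p.1 (axisPt p.2) + b p.1) 0 :=
      (EuclideanSpace.proj (0 : Fin 3)).continuous.measurable.comp hc
    have h2c : Measurable fun p : ℝ × EuclideanSpace ℝ (Fin 5) => (U p.1 (axisPt p.2) + b p.1) 2 :=
      (EuclideanSpace.proj (2 : Fin 3)).continuous.measurable.comp hc
    have hP : Measurable fun p : ℝ × EuclideanSpace ℝ (Fin 5) => ‖horizProj p.2‖⁻¹ • horizProj p.2 :=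
      ((horizProj.continuous.norm.measurable.comp measurable_snd).inv).smul
        (horizProj.continuous.measurable.comp measurable_snd)
    exact (h0c.smul hP).add (h2c.smul_const _)
  have hcb : ∀ t < 0, ∀ y : EuclideanSpace ℝ (Fin 5), ‖U t (axisPt y) + b t‖ ≤ C 0 + Cb := fun t ht y =>
    (norm_add_le _ _).trans (add_le_add
      (by have h := hC 0 t ht (axisPt y); rwa [norm_iteratedFDeriv_zero] at h) (hCb t))
  have ha_bdd : ∀ t < 0, ∀ y, ‖a t y‖ ≤ 2 * (C 0 + Cb) := by
    intro t ht y
    have hunit : ‖‖horizProj y‖⁻¹ • horizProj y‖ ≤ 1 := by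
      rw [norm_smul, norm_inv, norm_norm]
      by_cases h : ‖horizProj y‖ = 0
      · rw [h]; simp
      · rw [inv_mul_cancel₀ h]
    have e0 : |(U t (axisPt y) + b t) 0| ≤ C 0 + Cb :=
      le_trans (by simpa using PiLp.norm_apply_le (U t (axisPt y) + b t) 0) (hcb t ht y)
    have e2 : |(U t (axisPt y) + b t) 2| ≤ C 0 + Cb :=
      le_trans (by simpa using PiLp.norm_apply_le (U t (axisPt y) + b t) 2) (hcb t ht y)
    have hnn : 0 ≤ C 0 + Cb := (abs_nonneg _).trans e0
    calc ‖a t y‖ ≤ ‖(U t (axisPt y) + b t) 0 • (‖horizProj y‖⁻¹ • horizProj y)‖ +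
          ‖(U t (axisPt y) + b t) 2 • EuclideanSpace.single 4 (1 : ℝ)‖ := norm_add_le _ _
      _ ≤ (C 0 + Cb) * 1 + (C 0 + Cb) * 1 := by
          rw [norm_smul ((U t (axisPt y) + b t) 0), norm_smul ((U t (axisPt y) + b t) 2), Real.norm_eq_abs,
            Real.norm_eq_abs, PiLp.norm_single, norm_one]
          exact add_le_add (mul_le_mul e0 hunit (norm_nonneg _) hnn) (mul_le_mul_of_nonneg_right e2 zero_le_one)
      _ = 2 * (C 0 + Cb) := by ring
  have hF_bdd : ∃ C' : ℝ, ∀ t < 0, ∀ y, |F t y| ≤ C' :=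
    ⟨‖curlCLM‖ * C 2, fun t ht y => (hfB t ht (axisPt y)).1⟩
  have hF2 : ∀ t < 0, ContDiff ℝ 2 (F t) := fun t ht => contDiff_two_liftAx (hf4 t ht) (hev t ht)
  have hFD : ∃ C' : ℝ, ∀ t < 0, ∀ y, ‖fderiv ℝ (F t) y‖ ≤ C' ∧ |(Δ (F t)) y| ≤ C' := by
    refine ⟨max (2 * (‖curlCLM‖ * C 3)) (5 * (‖curlCLM‖ * C 4)), fun t ht y => ⟨?_, ?_⟩⟩
    · rw [show F t = liftAx (f t) from rfl, fderiv_liftAx (hf2 t ht) (h0 t ht)]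
      exact (norm_liftDeriv_le (hf2 t ht) (h0 t ht) (fun x => (hfB t ht x).2.1) y).trans (le_max_left _ _)
    · exact (abs_laplacian_liftAx_le (hf4 t ht) (hev t ht) (fun i x => (hfB t ht x).2.2.1 i) y).trans
        (le_max_right _ _)
  have hM : ∀ s < 0, ∀ t < 0, ∀ x,
      ‖fderiv ℝ (f t) x - fderiv ℝ (f s) x‖ ≤ ‖curlCLM‖ * max (L 3) (L 4) * |t - s| ∧
      (∀ i : Fin 3, |fderiv ℝ (fun z => fderiv ℝ (f t) z (EuclideanSpace.single i 1)) x (EuclideanSpace.single i 1) -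
        fderiv ℝ (fun z => fderiv ℝ (f s) z (EuclideanSpace.single i 1)) x (EuclideanSpace.single i 1)| ≤
          ‖curlCLM‖ * max (L 3) (L 4) * |t - s|) ∧
      |hadamardQuotFst (fun z => fderiv ℝ (f t) z (EuclideanSpace.single 0 1)) x -
        hadamardQuotFst (fun z => fderiv ℝ (f s) z (EuclideanSpace.single 0 1)) x| ≤
          ‖curlCLM‖ * max (L 3) (L 4) * |t - s| := by
    intro s hs t ht x
    have h3 : ‖curlCLM‖ * L 3 * |t - s| ≤ ‖curlCLM‖ * max (L 3) (L 4) * |t - s| :=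
      mul_le_mul_of_nonneg_right (mul_le_mul_of_nonneg_left (le_max_left _ _) (norm_nonneg curlCLM))
        (abs_nonneg _)
    have h4 : ‖curlCLM‖ * L 4 * |t - s| ≤ ‖curlCLM‖ * max (L 3) (L 4) * |t - s| :=
      mul_le_mul_of_nonneg_right (mul_le_mul_of_nonneg_left (le_max_right _ _) (norm_nonneg curlCLM))
        (abs_nonneg _)
    obtain ⟨-, hD, hii, hq⟩ := hfL s hs t ht x
    exact ⟨hD.trans h3, fun i => (hii i).trans h4, hq.trans h4⟩
  obtain ⟨hcontD, hcontΔ⟩ := liftAx_family_continuousOn (g := f) hf hfax hM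
  have heq : ∀ y, ∀ s t : ℝ, s ≤ t → t < 0 →
      F t y - F s y = ∫ τ in s..t, ((Δ (F τ)) y - fderiv ℝ (F τ) y (a τ y)) := fun y s t hst ht =>
    liftAx_equation hsmooth hC hL hUm hbm hCb hvort hgood hstr y hst ht
  -- the obstruction `|y₀| |f̃| ≤ r |f| = |ω| ≤ ‖curl‖ C₁`
  have hK : ∀ t < 0, ∀ y, |y 0| * |F t y| ≤ ‖curlCLM‖ * C 1 := by
    intro t ht y
    have h1 : |y 0| ≤ ‖horizProj y‖ := by
      have h := PiLp.norm_apply_le (horizProj y) 0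
      rwa [Real.norm_eq_abs, horizProj_apply_of_ne (show (0 : Fin 5) ≠ 4 by decide)] at h
    have hJ : ‖rotGen (axisPt y)‖ = ‖horizProj y‖ := by
      have hsq : ‖rotGen (axisPt y)‖ ^ 2 = ‖horizProj y‖ ^ 2 := by
        rw [← real_inner_self_eq_norm_sq, inner_rotGen_self_eq, axisPt_apply_zero, axisPt_apply_one]; ring
      rw [← Real.sqrt_sq (norm_nonneg (rotGen (axisPt y))), hsq, Real.sqrt_sq (norm_nonneg _)]
    have h2 : ‖horizProj y‖ * |F t y| = ‖curl (U t) (axisPt y)‖ := by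
      have hF : F t y = f t (axisPt y) := rfl
      rw [hF, hcurl t ht, norm_smul, Real.norm_eq_abs, hJ, mul_comm]
    have h3 : ‖curl (U t) (axisPt y)‖ ≤ ‖curlCLM‖ * C 1 := by
      rw [curl_eq_curlCLM]
      refine (curlCLM.le_opNorm _).trans ?_
      rw [norm_fderiv_eq_norm_iteratedFDeriv_one]
      exact mul_le_mul_of_nonneg_left (hC 1 t ht _) (norm_nonneg curlCLM)
    calc |y 0| * |F t y| ≤ ‖horizProj y‖ * |F t y| := mul_le_mul_of_nonneg_right h1 (abs_nonneg _)
      _ = ‖curl (U t) (axisPt y)‖ := h2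
      _ ≤ _ := h3
  have hzero := KNSS2009_lemma21_halfball.eq_zero_of_abs_mul_le hball ha_meas ha_bdd hF_bdd hF2 hFD
    hcontD hcontΔ heq hK
  -- conclusion: `f = 0`, `ω = f J = 0`
  intro t ht x
  have hfx : f t x = 0 := by
    rw [(hfax t ht).eq_comp_meridian x, ← axisPt_lift_point x]
    exact hzero t ht _
  rw [hcurl t ht x, hfx, zero_smul]

/-- **KNSS 2009, Theorem 5.2, from the §4 regularity fact and Lemma 2.1 on `ℝ⁵`.** The printed
Liouville theorem for axisymmetric bounded ancient weak solutions without swirl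
(`KNSS2009_liouville_axisymmetric_no_swirl`: `u(x, t) = (0, 0, b₃(t))`) follows from the two
named facts `KNSS2009_regularity_boundedWeak_ancient` (KNSS §4: smooth bounded representative
`U + b(t)`, vorticity equation) and `KNSS2009_lemma21_halfball (EuclideanSpace ℝ (Fin 5))`
(KNSS Lemma 2.1 in the form used in §5), through `curl_eq_zero_of_KNSS2009_facts` (the
maximum-principle argument for `f = ω_θ / r` lifted to `ℝ⁵`) and `KNSS2009_thm52_of_curl_eq_zero'`
(the Liouville theorem for `curl u = 0`, `div u = 0`, `KNSSThm52End`/`CurlFreeLiouville`).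
[cite: KochNadirashviliSereginSverak2009, Thm 5.2 (arXiv pp. 9–10)] -/
theorem KNSS2009_liouville_axisymmetric_no_swirl_of_facts (hreg : KNSS2009_regularity_boundedWeak_ancient)
    (hball : KNSS2009_lemma21_halfball (EuclideanSpace ℝ (Fin 5))) :
    KNSS2009_liouville_axisymmetric_no_swirl := by
  intro u hu hrot hsw
  obtain ⟨U, b, hbm, hbC, hUm, hae, hsmooth, hdiv, hbd, hlip, hvort⟩ := hreg hu
  exact KNSS2009_thm52_of_curl_eq_zero' hrot hbm hbC hUm hae hsmooth hdiv hbd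
    (curl_eq_zero_of_KNSS2009_facts hball hrot hsw hbm hbC hUm hae hsmooth hbd hlip hvort)

/-- **The corrected duality-form fact `knss2009_axisymmetric_no_swirl` from the same two named
facts** (through `knss2009_axisymmetric_no_swirl_of_KNSS2009`, `KNSSAxisymmetricNoSwirl`).
[cite: KochNadirashviliSereginSverak2009, Thm 5.2 (arXiv pp. 9–10)] -/
theorem knss2009_axisymmetric_no_swirl_of_facts (hreg : KNSS2009_regularity_boundedWeak_ancient)
    (hball : KNSS2009_lemma21_halfball (EuclideanSpace ℝ (Fin 5))) : knss2009_axisymmetric_no_swirl :=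
  knss2009_axisymmetric_no_swirl_of_KNSS2009 (KNSS2009_liouville_axisymmetric_no_swirl_of_facts hreg hball)

end Assembly

end Literature.Analysis.FluidPDE

end
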